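import Literature.Analysis.FluidPDE.ChaeChoeCriterion
import HarnessLib

/-!
# Two velocity components in the Prodi–Serrin class: the Bae–Choe criterion, PROVED

search for candidate a priori estimates; no regularity claim (cell `pub-nsfunc`, literature seat:
a published continuation criterion as a THEOREM; nothing new).

H.-O. Bae, H. J. Choe, *A regularity criterion for the Navier–Stokes equations*, Comm. Partial
Differential Equations 32 (2007) 1173–1187, Thm. 1 (paywalled; acquisition `acq-09538`), as
restated and re-proved (in the half space) by H. Beirão da Veiga, *On the extension to slip
boundary conditions of a Bae and Choe regularity criterion for the Navier–Stokes equations. The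
half-space case*, J. Math. Anal. Appl. 453 (2017) 212–220 = arXiv:1612.07051 (open, READ): a
Leray–Hopf weak solution on `ℝ³ × (0,T)` is strong (`u ∈ L^∞(0,T;H¹) ∩ L²(0,T;H²)`, (1.4)) as
soon as `ū = (u₁, u₂, 0)` — "any 2-dimensional component of the velocity" — satisfies the
Prodi–Serrin condition `ū ∈ L^q(0,T; L^p)`, `2/q + 3/p ≤ 1`, `p > 3` ((1.3), statement after
(1.9)). Printed proof: the gradient-enstrophy balance (1.5), the structure estimate
`|∫∇[(u·∇)u]·∇u| ≤ c∫|ū||∇u||∇²u|` ((1.9), proved in §2 by the three cases `i ≠ n`;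
`i = n, j ≠ n`; `i = j = n` and integrations by parts), then Hölder
`‖|ū|∇u‖₂ ≤ ‖ū‖_p‖∇u‖_{2p/(p−2)}`, interpolation and Sobolev
`‖∇u‖_{2p/(p−2)} ≤ c‖∇u‖₂^{1−3/p}‖∇²u‖₂^{3/p}`, Young and Grönwall ((2.11)–(2.14)).

Rendering (that of the tree's `chaeChoe_two_vorticity_components_criterion`, ns.S27): a classical
unforced solution on `ℝ³ × [0, T)` in the Beale–Kato–Majda class on every `[0, T'']`, `T'' < T`;
for an index `k` the two OTHER velocity components `u_j`, `j ≠ k`, lie in `L^α(0,T; L^γ)`,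
`2/α + 3/γ = 1`, `3 < γ < ∞`; conclusion `HasSobolevExtensionPast ν u T`. We use the VORTICITY
balance (the pressure-free slab Grönwall inequality `integral_sq_norm_curl_le_mul_exp_of_weight_slab_ae`
of `EnstrophyWeightSlab`) instead of the gradient balance of the paper; the structure estimate
becomes `integral_inner_curl_stretching_le_two_components`: writing
`⟪ω, (∇u)ω⟫ = Σᵢ ωᵢ ∇uᵢ·ω`, the terms `i ≠ k` are integrated by parts off `uᵢ`, and in the term
`i = k` the component `ω_k = ∂_{k+1}u_{k+2} − ∂_{k+2}u_{k+1}` is integrated by parts off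
`u_{k+1}, u_{k+2}`; the second derivatives of `u` so produced are controlled in `L²` by `∇ω`
(`‖∇²u‖₂ ≤ 3‖∇ω‖₂` for divergence-free `u`, via `div ∂_ℓu = 0`, `curl ∂_ℓu = ∂_ℓω` and the
tree's `∫|∇w|²_F ≤ ∫|curl w|²`), and `‖∇u‖_m ≤ C₁‖ω‖_m` is the tree's Calderón–Zygmund bound.
The analytic chain (three-factor Hölder, interpolation `2`–`6`, Sobolev, Young) is the printed one.

* `integral_inner_curl_stretching_le_two_components` — the structure estimate (vorticity form);
* `exists_two_mul_integral_stretching_le_of_two_velocity_components` — the fixed-time estimate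
  `2∫⟪ω,(∇u)ω⟫ ≤ ν∫|∇ω|²_F + C(‖u_{k+1}‖_γ^q + ‖u_{k+2}‖_γ^q)∫|ω|²`, `q = 2γ/(γ−3)`;
* `exists_uniform_H1_bound_of_two_velocity_components` — the a priori `H¹` bound;
* `baeChoe_two_velocity_components_criterion` — **the criterion** (`2/α + 3/γ = 1`);
* `baeChoe_two_velocity_components_criterion_of_le` — `2/α + 3/γ ≤ 1`, `α ≤ ∞`.

* `two_mul_integral_stretching_le_of_two_velocity_components_top`,
  `baeChoe_two_velocity_components_criterion_top` — the endpoint `γ = ∞`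
  (`ū ∈ L²(0,T; L^∞)`: `2∫⟪ω,(∇u)ω⟫ ≤ ν∫|∇ω|²_F + (138/ν)(‖u_{k+1}‖_∞ + ‖u_{k+2}‖_∞)²∫|ω|²`,
  Young on the three products of the structure estimate), `…_top_of_le`
  (`L^α(0,T; L^∞)`, `2 ≤ α ≤ ∞`).

## References

* H.-O. Bae, H. J. Choe, Comm. Partial Differential Equations 32 (2007), no. 7, 1173–1187,
  Thm. 1 (paywalled, acq-09538; statement taken from the secondary source). [BaeChoe2007CPDE]
* H. Beirão da Veiga, J. Math. Anal. Appl. 453 (2017), 212–220 (arXiv:1612.07051): §1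
  (1.3)–(1.11), the statement of the Bae–Choe criterion after (1.9), Thm. 1.1, and §2 (the three
  cases, (2.11)–(2.14)) (open access; text read). [BeiraodaVeiga2017JMAA]
* T. Tao, Anal. PDE 6 (2013), Lemma 8.1 (energy class). [Tao2011]
-/

noncomputable section

open MeasureTheory Set Function Filter Metric Real InnerProductSpace
open _root_.Topology
open scoped ENNReal NNReal RealInnerProductSpace ContDiff

namespace Literature.Analysis.FluidPDE

set_option maxSynthPendingDepth 3

section Structure

variable {v : EuclideanSpace ℝ (Fin 3) → EuclideanSpace ℝ (Fin 3)}

/-- A component is bounded by the vector: `|y k| ≤ ‖y‖`. [folklore] -/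
private theorem abs_apply_le_norm_bc (y : EuclideanSpace ℝ (Fin 3)) (k : Fin 3) : |y k| ≤ ‖y‖ := by
  have h := EuclideanSpace.norm_sq_eq y
  have hk : |y k| ^ 2 ≤ ∑ j, |y j| ^ 2 :=
    Finset.single_le_sum (f := fun j => |y j| ^ 2) (fun j _ => sq_nonneg _) (Finset.mem_univ k)
  have h2 : |y k| ^ 2 ≤ ‖y‖ ^ 2 := by
    rw [h]
    simpa only [Real.norm_eq_abs] using hk
  exact abs_le_of_sq_le_sq' (by nlinarith [norm_nonneg y, abs_nonneg (y k)]) (norm_nonneg _) |>.2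

/-- `⟪w, z⟫ = Σ` over the three indices `k, k+1, k+2`. [folklore] -/
private theorem inner_eq_sum_three_bc (w z : EuclideanSpace ℝ (Fin 3)) (k : Fin 3) :
    ⟪w, z⟫ = w k * z k + w (k + 1) * z (k + 1) + w (k + 2) * z (k + 2) := by
  rw [EuclideanSpace.inner_eq_star_dotProduct]
  fin_cases k <;> simp [dotProduct, Fin.sum_univ_three] <;> ring

/-- Components of the Fréchet derivative of a field: `(Dw(x) a)ₗ = D(wₗ)(x) a`. [folklore] -/
private theorem fderiv_apply_apply_eq_bc {w : EuclideanSpace ℝ (Fin 3) → EuclideanSpace ℝ (Fin 3)}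
    {x : EuclideanSpace ℝ (Fin 3)} (hw : DifferentiableAt ℝ w x)
    (a : EuclideanSpace ℝ (Fin 3)) (l : Fin 3) :
    fderiv ℝ w x a l = fderiv ℝ (fun y => w y l) x a := by
  have h : (fun y => w y l) =
      (EuclideanSpace.proj l : EuclideanSpace ℝ (Fin 3) →L[ℝ] ℝ) ∘ w := rfl
  rw [h, ((EuclideanSpace.proj l).hasFDerivAt.comp x hw.hasFDerivAt).fderiv]
  rfl

/-- A component function of a `Cⁿ` field is `Cⁿ`. [folklore] -/
private theorem contDiff_apply_bc {n : WithTop ℕ∞} (hv : ContDiff ℝ n v) (l : Fin 3) :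
    ContDiff ℝ n fun y => v y l := by
  have h : (fun y => v y l) = (EuclideanSpace.proj l : EuclideanSpace ℝ (Fin 3) →L[ℝ] ℝ) ∘ v := rfl
  rw [h]; exact (EuclideanSpace.proj l).contDiff.comp hv

/-- `‖D(v_l)(x)‖ ≤ ‖Dv(x)‖`. [folklore] -/
private theorem norm_fderiv_apply_le_bc (hv : Differentiable ℝ v) (x : EuclideanSpace ℝ (Fin 3))
    (l : Fin 3) : ‖fderiv ℝ (fun y => v y l) x‖ ≤ ‖fderiv ℝ v x‖ := by
  refine ContinuousLinearMap.opNorm_le_bound _ (norm_nonneg _) fun a => ?_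
  rw [← fderiv_apply_apply_eq_bc (hv x) a l, Real.norm_eq_abs]
  exact (abs_apply_le_norm_bc _ l).trans ((fderiv ℝ v x).le_opNorm a)

/-- Integrability from a product bound by two square-integrable functions. [folklore] -/
private theorem integrable_of_le_mul_bc {F : EuclideanSpace ℝ (Fin 3) → ℝ}
    (hF : AEStronglyMeasurable F volume) {p q : EuclideanSpace ℝ (Fin 3) → ℝ}
    (hp : Integrable (fun x => p x ^ 2) volume) (hq : Integrable (fun x => q x ^ 2) volume)
    {C : ℝ} (hC : 0 ≤ C) (h : ∀ x, ‖F x‖ ≤ C * (p x * q x)) : Integrable F volume := by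
  have hdom : Integrable (fun x => C / 2 * (p x ^ 2 + q x ^ 2)) volume := (hp.add hq).const_mul (C / 2)
  refine hdom.mono' hF (Eventually.of_forall fun x => ?_)
  refine (h x).trans ?_
  nlinarith [sq_nonneg (p x - q x)]

/-- One integration by parts on `ℝ³` for `C¹` functions with integrable products. [folklore] -/
private theorem ibp_bc {f g : EuclideanSpace ℝ (Fin 3) → ℝ} (hf : ContDiff ℝ 1 f) (hg : ContDiff ℝ 1 g)
    (a : EuclideanSpace ℝ (Fin 3))
    (i1 : Integrable (fun x => fderiv ℝ f x a * g x) volume)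
    (i2 : Integrable (fun x => f x * fderiv ℝ g x a) volume)
    (i3 : Integrable (fun x => f x * g x) volume) :
    ∫ x, f x * fderiv ℝ g x a = -∫ x, fderiv ℝ f x a * g x :=
  integral_mul_fderiv_eq_neg_fderiv_mul_of_integrable i1 i2 i3
    (fun x _ => (hf.differentiable one_ne_zero) x) (fun x _ => (hg.differentiable one_ne_zero) x)

set_option maxHeartbeats 1600000 in
/-- **The Bae–Choe structure estimate, vorticity form** (Bae–Choe 2007; Beirão da Veiga 2017,
(1.8)–(1.9): "a last integration by parts shows that
`|∫∇[(u·∇)u]·∇u| ≤ c(n)∫|ū| |∇u| |∇²u|`, `ū = (u₁,…,u_{n−1},0)` … the proof is based on a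
clever analysis of the structure of the integral", cases `i ≠ n`; `i = n, j ≠ n`; `i = j = n`).
Here, for the VORTICITY stretching of a `C³` field `v` on `ℝ³` with `v, ∇v` bounded and
`∇v, ∇²v ∈ L²`, and an index `k`: writing `⟪ω, (∇v)ω⟫ = Σᵢ ωᵢ (∇vᵢ·ω)`, the terms `i ≠ k` are
integrated by parts off `vᵢ` (`∫ωᵢω_ℓ∂_ℓvᵢ = −∫vᵢ∂_ℓ(ωᵢω_ℓ)`), and in the term `i = k` the
component `ω_k = ∂_{k+1}v_{k+2} − ∂_{k+2}v_{k+1}` is integrated by parts off `v_{k+1}, v_{k+2}`.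
Result: `∫⟪ω, (∇v)ω⟫ ≤ ∫ (|v_{k+1}| + |v_{k+2}|)·(6|∇ω||ω| + |∇v||∇ω| + |∇(∇v_k)||ω|)`.
[cite: BeiraodaVeiga2017JMAA, §1 (1.8)–(1.9) and §2 (the three cases) (pp. 2–6); BaeChoe2007CPDE, Thm. 1] -/
theorem integral_inner_curl_stretching_le_two_components (k : Fin 3) (hv : ContDiff ℝ 3 v)
    {B : ℝ} (hB : ∀ x, ‖v x‖ ≤ B) {B₁ : ℝ} (hB₁ : ∀ x, ‖fderiv ℝ v x‖ ≤ B₁)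
    (hv1 : ∫⁻ x, ‖iteratedFDeriv ℝ 1 v x‖ₑ ^ 2 < ⊤) (hv2 : ∫⁻ x, ‖iteratedFDeriv ℝ 2 v x‖ₑ ^ 2 < ⊤) :
    ∫ x, ⟪curl v x, fderiv ℝ v x (curl v x)⟫ ≤
      ∫ x, (|v x (k + 1)| + |v x (k + 2)|) *
        (6 * (‖fderiv ℝ (curl v) x‖ * ‖curl v x‖) + ‖fderiv ℝ v x‖ * ‖fderiv ℝ (curl v) x‖ +
          ‖fderiv ℝ (fderiv ℝ (fun y => v y k)) x‖ * ‖curl v x‖) := by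
  set e := EuclideanSpace.basisFun (Fin 3) ℝ with he
  have he1 : ∀ i, ‖e i‖ = 1 := fun i => by simp [he]
  set om : EuclideanSpace ℝ (Fin 3) → EuclideanSpace ℝ (Fin 3) := curl v with homdef
  have hv2c : ContDiff ℝ 2 v := hv.of_le (by norm_cast)
  have hv1c : ContDiff ℝ 1 v := hv.of_le (by norm_cast)
  have hom2 : ContDiff ℝ 2 om := contDiff_curl hv
  have hom1 : ContDiff ℝ 1 om := hom2.of_le (by norm_cast)
  have dv : Differentiable ℝ v := hv1c.differentiable one_ne_zero
  have dom : Differentiable ℝ om := hom1.differentiable one_ne_zero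
  have cv : Continuous v := hv.continuous
  have cω : Continuous om := hom2.continuous
  have cDv : Continuous (fderiv ℝ v) := hv.continuous_fderiv (by simp)
  have cDω : Continuous (fderiv ℝ om) := hom2.continuous_fderiv (by simp)
  have hB0 : 0 ≤ B := (norm_nonneg _).trans (hB 0)
  have hB₁0 : 0 ≤ B₁ := (norm_nonneg _).trans (hB₁ 0)
  -- scalar components
  set vc : Fin 3 → EuclideanSpace ℝ (Fin 3) → ℝ := fun j y => v y j with hvc
  set oc : Fin 3 → EuclideanSpace ℝ (Fin 3) → ℝ := fun j y => om y j with hoc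
  have hvc2 : ∀ j, ContDiff ℝ 2 (vc j) := fun j => contDiff_apply_bc hv2c j
  have hvc1 : ∀ j, ContDiff ℝ 1 (vc j) := fun j => contDiff_apply_bc hv1c j
  have hoc1 : ∀ j, ContDiff ℝ 1 (oc j) := fun j => contDiff_apply_bc hom1 j
  have cvc : ∀ j, Continuous (vc j) := fun j => (hvc1 j).continuous
  have coc : ∀ j, Continuous (oc j) := fun j => (hoc1 j).continuous
  have cDvc : ∀ j, Continuous (fderiv ℝ (vc j)) := fun j => (hvc1 j).continuous_fderiv one_ne_zero
  have cDoc : ∀ j, Continuous (fderiv ℝ (oc j)) := fun j => (hoc1 j).continuous_fderiv one_ne_zero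
  have hvc_le : ∀ j x, |vc j x| ≤ ‖v x‖ := fun j x => abs_apply_le_norm_bc (v x) j
  have hoc_le : ∀ j x, |oc j x| ≤ ‖om x‖ := fun j x => abs_apply_le_norm_bc (om x) j
  have hDvc_le : ∀ j x, ‖fderiv ℝ (vc j) x‖ ≤ ‖fderiv ℝ v x‖ := fun j x => norm_fderiv_apply_le_bc dv x j
  have hDoc_le : ∀ j x, ‖fderiv ℝ (oc j) x‖ ≤ ‖fderiv ℝ om x‖ := fun j x =>
    norm_fderiv_apply_le_bc dom x j
  have hDvc_a : ∀ j x a, |fderiv ℝ (vc j) x a| ≤ ‖fderiv ℝ v x‖ * ‖a‖ := fun j x a => by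
    rw [← Real.norm_eq_abs]; exact ((fderiv ℝ (vc j) x).le_opNorm a).trans
      (mul_le_mul_of_nonneg_right (hDvc_le j x) (norm_nonneg _))
  have hDoc_a : ∀ j x a, |fderiv ℝ (oc j) x a| ≤ ‖fderiv ℝ om x‖ * ‖a‖ := fun j x a => by
    rw [← Real.norm_eq_abs]; exact ((fderiv ℝ (oc j) x).le_opNorm a).trans
      (mul_le_mul_of_nonneg_right (hDoc_le j x) (norm_nonneg _))
  -- square-integrable quantities
  have l2ω : ∫⁻ x, ‖om x‖ₑ ^ 2 < ⊤ :=
    lt_of_le_of_lt (lintegral_curl_sq_le v) (ENNReal.mul_lt_top ENNReal.ofReal_lt_top hv1)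
  have l2Dv : ∫⁻ x, ‖fderiv ℝ v x‖ₑ ^ 2 < ⊤ := by
    refine lt_of_le_of_lt (le_of_eq (lintegral_congr fun x => ?_)) hv1
    rw [← ofReal_norm, ← ofReal_norm, norm_iteratedFDeriv_one v]
  have l2Dω : ∫⁻ x, ‖fderiv ℝ om x‖ₑ ^ 2 < ⊤ := by
    have hle : ∀ x, ‖fderiv ℝ om x‖ ≤ ‖(‖curlCLM‖) • iteratedFDeriv ℝ 2 v x‖ := fun x => by
      rw [norm_smul, Real.norm_of_nonneg (norm_nonneg _), homdef]
      exact norm_fderiv_curl_le hv2c x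
    exact lintegral_enorm_sq_lt_top_of_norm_le hle (lintegral_enorm_sq_const_smul_lt_top _ hv2)
  have hDDk : ∀ x, ‖fderiv ℝ (fderiv ℝ (vc k)) x‖ ≤ ‖iteratedFDeriv ℝ 2 v x‖ := by
    intro x
    have h1 : ‖fderiv ℝ (fderiv ℝ (vc k)) x‖ = ‖iteratedFDeriv ℝ 2 (vc k) x‖ := by
      rw [← norm_iteratedFDeriv_fderiv, norm_iteratedFDeriv_one]
    have h2 : (vc k) = (EuclideanSpace.proj k : EuclideanSpace ℝ (Fin 3) →L[ℝ] ℝ) ∘ v := rfl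
    rw [h1, h2, ContinuousLinearMap.iteratedFDeriv_comp_left _ hv2c.contDiffAt (by norm_cast)]
    refine (ContinuousLinearMap.norm_compContinuousMultilinearMap_le _ _).trans ?_
    have hP : ‖(EuclideanSpace.proj k : EuclideanSpace ℝ (Fin 3) →L[ℝ] ℝ)‖ ≤ 1 := by
      refine ContinuousLinearMap.opNorm_le_bound _ zero_le_one fun y => ?_
      rw [one_mul, Real.norm_eq_abs]; exact abs_apply_le_norm_bc y k
    calc ‖(EuclideanSpace.proj k : EuclideanSpace ℝ (Fin 3) →L[ℝ] ℝ)‖ * ‖iteratedFDeriv ℝ 2 v x‖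
        ≤ 1 * ‖iteratedFDeriv ℝ 2 v x‖ := by gcongr
      _ = ‖iteratedFDeriv ℝ 2 v x‖ := one_mul _
  have cDDk : Continuous (fderiv ℝ (fderiv ℝ (vc k))) :=
    ((hvc2 k).fderiv_right (m := 1) (by norm_num)).continuous_fderiv one_ne_zero
  have l2DDk : ∫⁻ x, ‖fderiv ℝ (fderiv ℝ (vc k)) x‖ₑ ^ 2 < ⊤ := by
    have hle : ∀ x, ‖fderiv ℝ (fderiv ℝ (vc k)) x‖ ≤ ‖(1 : ℝ) • iteratedFDeriv ℝ 2 v x‖ := fun x => by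
      rw [one_smul]; exact hDDk x
    exact lintegral_enorm_sq_lt_top_of_norm_le hle (lintegral_enorm_sq_const_smul_lt_top _ hv2)
  have iω2 : Integrable (fun x => ‖om x‖ ^ 2) volume := integrable_sq_norm_of_lintegral_lt_top cω l2ω
  have iDv2 : Integrable (fun x => ‖fderiv ℝ v x‖ ^ 2) volume :=
    integrable_sq_norm_of_lintegral_lt_top cDv l2Dv
  have iDω2 : Integrable (fun x => ‖fderiv ℝ om x‖ ^ 2) volume :=
    integrable_sq_norm_of_lintegral_lt_top cDω l2Dω
  have iDDk2 : Integrable (fun x => ‖fderiv ℝ (fderiv ℝ (vc k)) x‖ ^ 2) volume :=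
    integrable_sq_norm_of_lintegral_lt_top cDDk l2DDk
  -- (1) expansion of the integrand
  have hexp : ∀ x, ⟪om x, fderiv ℝ v x (om x)⟫ =
      oc k x * fderiv ℝ (vc k) x (om x) +
        (oc (k + 1) x * fderiv ℝ (vc (k + 1)) x (om x) + oc (k + 2) x * fderiv ℝ (vc (k + 2)) x (om x)) := by
    intro x
    rw [inner_eq_sum_three_bc (om x) (fderiv ℝ v x (om x)) k, fderiv_apply_apply_eq_bc (dv x),
      fderiv_apply_apply_eq_bc (dv x), fderiv_apply_apply_eq_bc (dv x)]
    ring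
  -- (2) the terms `i ≠ k`: `∫ ωᵢ ∇vᵢ·ω = -∫ vᵢ Σ_ℓ ∂_ℓ(ωᵢ ω_ℓ) ≤ ∫ |vᵢ| 6|∇ω||ω|`
  have hterm : ∀ i, ∫ x, oc i x * fderiv ℝ (vc i) x (om x) ≤
      ∫ x, |vc i x| * (6 * (‖fderiv ℝ om x‖ * ‖om x‖)) := by
    intro i
    -- expand `ω = Σ ω_ℓ e_ℓ`
    have hsum : ∀ x, oc i x * fderiv ℝ (vc i) x (om x) =
        ∑ l, (oc i x * oc l x) * fderiv ℝ (vc i) x (e l) := by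
      intro x
      have hw : om x = ∑ l, (om x l) • e l := ((EuclideanSpace.basisFun (Fin 3) ℝ).sum_repr (om x)).symm
      conv_lhs => rw [hw]
      rw [map_sum, Finset.mul_sum]
      refine Finset.sum_congr rfl fun l _ => ?_
      rw [map_smul, smul_eq_mul]; ring
    -- the products `ωᵢ ω_ℓ`
    have hf : ∀ l, ContDiff ℝ 1 (fun x => oc i x * oc l x) := fun l => (hoc1 i).mul (hoc1 l)
    have hDf : ∀ l x a, fderiv ℝ (fun x => oc i x * oc l x) x a =
        fderiv ℝ (oc i) x a * oc l x + oc i x * fderiv ℝ (oc l) x a := by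
      intro l x a
      rw [fderiv_fun_mul ((hoc1 i).differentiable one_ne_zero x) ((hoc1 l).differentiable one_ne_zero x)]
      simp only [_root_.add_apply, FunLike.coe_smul, Pi.smul_apply, smul_eq_mul]
      ring
    have hDf_le : ∀ l x, |fderiv ℝ (fun x => oc i x * oc l x) x (e l)| ≤ 2 * (‖fderiv ℝ om x‖ * ‖om x‖) := by
      intro l x
      rw [hDf]
      have h1 : |fderiv ℝ (oc i) x (e l)| ≤ ‖fderiv ℝ om x‖ := by
        have := hDoc_a i x (e l); rwa [he1, mul_one] at this
      have h2 : |fderiv ℝ (oc l) x (e l)| ≤ ‖fderiv ℝ om x‖ := by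
        have := hDoc_a l x (e l); rwa [he1, mul_one] at this
      have h3 := hoc_le l x
      have h4 := hoc_le i x
      calc |fderiv ℝ (oc i) x (e l) * oc l x + oc i x * fderiv ℝ (oc l) x (e l)|
          ≤ |fderiv ℝ (oc i) x (e l)| * |oc l x| + |oc i x| * |fderiv ℝ (oc l) x (e l)| := by
            refine (abs_add_le _ _).trans ?_; rw [abs_mul, abs_mul]
        _ ≤ ‖fderiv ℝ om x‖ * ‖om x‖ + ‖om x‖ * ‖fderiv ℝ om x‖ := by
            gcongr
        _ = 2 * (‖fderiv ℝ om x‖ * ‖om x‖) := by ring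
    -- integrability of the three products of each IBP
    have mvc : AEStronglyMeasurable (vc i) volume := (cvc i).aestronglyMeasurable
    have i1 : ∀ l, Integrable (fun x => fderiv ℝ (fun x => oc i x * oc l x) x (e l) * vc i x) volume := by
      intro l
      refine integrable_of_le_mul_bc ((((hf l).continuous_fderiv one_ne_zero).clm_apply
        continuous_const).mul (cvc i)).aestronglyMeasurable iDω2 iω2 (by positivity : (0:ℝ) ≤ 2 * B)
        fun x => ?_
      rw [norm_mul, Real.norm_eq_abs, Real.norm_eq_abs]
      have h1 := hDf_le l x
      have h2 : |vc i x| ≤ B := (hvc_le i x).trans (hB x)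
      calc |fderiv ℝ (fun x => oc i x * oc l x) x (e l)| * |vc i x|
          ≤ (2 * (‖fderiv ℝ om x‖ * ‖om x‖)) * B := by gcongr
        _ = 2 * B * (‖fderiv ℝ om x‖ * ‖om x‖) := by ring
    have i2 : ∀ l, Integrable (fun x => (oc i x * oc l x) * fderiv ℝ (vc i) x (e l)) volume := by
      intro l
      refine integrable_of_le_mul_bc ((((coc i).mul (coc l))).mul ((cDvc i).clm_apply
        continuous_const)).aestronglyMeasurable iω2 iω2 hB₁0 fun x => ?_
      rw [norm_mul, norm_mul, Real.norm_eq_abs, Real.norm_eq_abs, Real.norm_eq_abs]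
      have h1 : |fderiv ℝ (vc i) x (e l)| ≤ B₁ := by
        have := hDvc_a i x (e l); rw [he1, mul_one] at this; exact this.trans (hB₁ x)
      calc |oc i x| * |oc l x| * |fderiv ℝ (vc i) x (e l)| ≤ ‖om x‖ * ‖om x‖ * B₁ := by
            gcongr
            · exact hoc_le i x
            · exact hoc_le l x
        _ = B₁ * (‖om x‖ * ‖om x‖) := by ring
    have i3 : ∀ l, Integrable (fun x => (oc i x * oc l x) * vc i x) volume := by
      intro l
      refine integrable_of_le_mul_bc (((coc i).mul (coc l)).mul (cvc i)).aestronglyMeasurable iω2 iω2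
        hB0 fun x => ?_
      rw [norm_mul, norm_mul, Real.norm_eq_abs, Real.norm_eq_abs, Real.norm_eq_abs]
      have h2 : |vc i x| ≤ B := (hvc_le i x).trans (hB x)
      calc |oc i x| * |oc l x| * |vc i x| ≤ ‖om x‖ * ‖om x‖ * B := by
            gcongr
            · exact hoc_le i x
            · exact hoc_le l x
        _ = B * (‖om x‖ * ‖om x‖) := by ring
    -- integrate by parts each summand
    have hibp : ∀ l, ∫ x, (oc i x * oc l x) * fderiv ℝ (vc i) x (e l) =
        -∫ x, fderiv ℝ (fun x => oc i x * oc l x) x (e l) * vc i x := fun l =>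
      ibp_bc (hf l) (hvc1 i) (e l) (i1 l) (i2 l) (i3 l)
    have hL : ∫ x, oc i x * fderiv ℝ (vc i) x (om x) =
        -∫ x, (∑ l, fderiv ℝ (fun x => oc i x * oc l x) x (e l)) * vc i x := by
      rw [integral_congr_ae (Eventually.of_forall hsum)]
      rw [integral_finsetSum _ fun l _ => i2 l]
      simp_rw [hibp]
      rw [Finset.sum_neg_distrib, ← integral_finsetSum _ fun l _ => i1 l]
      congr 1
      refine integral_congr_ae (Eventually.of_forall fun x => ?_)
      simp only [Finset.sum_mul]
    rw [hL]
    have iR : Integrable (fun x => |vc i x| * (6 * (‖fderiv ℝ om x‖ * ‖om x‖))) volume := by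
      refine integrable_of_le_mul_bc (((cvc i).norm).mul (continuous_const.mul (cDω.norm.mul
        cω.norm))).aestronglyMeasurable iDω2 iω2 (by positivity : (0:ℝ) ≤ 6 * B) fun x => ?_
      rw [Real.norm_of_nonneg (by positivity)]
      have h2 : |vc i x| ≤ B := (hvc_le i x).trans (hB x)
      calc |vc i x| * (6 * (‖fderiv ℝ om x‖ * ‖om x‖)) ≤ B * (6 * (‖fderiv ℝ om x‖ * ‖om x‖)) := by
            gcongr
        _ = 6 * B * (‖fderiv ℝ om x‖ * ‖om x‖) := by ring
    have iL : Integrable (fun x => (∑ l, fderiv ℝ (fun x => oc i x * oc l x) x (e l)) * vc i x) volume := by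
      have : (fun x => (∑ l, fderiv ℝ (fun x => oc i x * oc l x) x (e l)) * vc i x) =
          fun x => ∑ l, fderiv ℝ (fun x => oc i x * oc l x) x (e l) * vc i x := by
        funext x; rw [Finset.sum_mul]
      rw [this]
      exact integrable_finsetSum _ fun l _ => i1 l
    rw [← integral_neg]
    refine integral_mono iL.neg iR fun x => ?_
    dsimp only
    have hs : |∑ l, fderiv ℝ (fun x => oc i x * oc l x) x (e l)| ≤ 6 * (‖fderiv ℝ om x‖ * ‖om x‖) := by
      refine (Finset.abs_sum_le_sum_abs _ _).trans ?_
      calc ∑ l, |fderiv ℝ (fun x => oc i x * oc l x) x (e l)|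
          ≤ ∑ _l : Fin 3, 2 * (‖fderiv ℝ om x‖ * ‖om x‖) := Finset.sum_le_sum fun l _ => hDf_le l x
        _ = 6 * (‖fderiv ℝ om x‖ * ‖om x‖) := by simp; ring
    have := abs_mul (∑ l, fderiv ℝ (fun x => oc i x * oc l x) x (e l)) (vc i x)
    nlinarith [neg_abs_le ((∑ l, fderiv ℝ (fun x => oc i x * oc l x) x (e l)) * vc i x), hs,
      abs_nonneg (vc i x), this, abs_nonneg (∑ l, fderiv ℝ (fun x => oc i x * oc l x) x (e l))]
  -- (3) the term `i = k`: `ω_k = ∂_{k+1} v_{k+2} - ∂_{k+2} v_{k+1}`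
  set h : EuclideanSpace ℝ (Fin 3) → ℝ := fun x => fderiv ℝ (vc k) x (om x) with hhdef
  have hh1 : ContDiff ℝ 1 h := by
    have hA : ContDiff ℝ 1 (fderiv ℝ (vc k)) := (hvc2 k).fderiv_right (m := 1) (by norm_num)
    exact hA.clm_apply hom1
  have ch : Continuous h := hh1.continuous
  have hh_le : ∀ x, |h x| ≤ ‖fderiv ℝ v x‖ * ‖om x‖ := fun x => hDvc_a k x (om x)
  have hDh : ∀ x, fderiv ℝ h x = (fderiv ℝ (vc k) x).comp (fderiv ℝ om x) +
      (fderiv ℝ (fderiv ℝ (vc k)) x).flip (om x) := by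
    intro x
    have hA : DifferentiableAt ℝ (fderiv ℝ (vc k)) x :=
      (((hvc2 k).fderiv_right (m := 1) (by norm_num)).differentiable one_ne_zero) x
    rw [hhdef, fderiv_clm_apply hA (dom x)]
  have hDh_le : ∀ x a, |fderiv ℝ h x a| ≤
      (‖fderiv ℝ v x‖ * ‖fderiv ℝ om x‖ + ‖fderiv ℝ (fderiv ℝ (vc k)) x‖ * ‖om x‖) * ‖a‖ := by
    intro x a
    rw [← Real.norm_eq_abs]
    refine ((fderiv ℝ h x).le_opNorm a).trans (mul_le_mul_of_nonneg_right ?_ (norm_nonneg _))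
    rw [hDh]
    refine (norm_add_le _ _).trans (add_le_add ?_ ?_)
    · exact (ContinuousLinearMap.opNorm_comp_le _ _).trans
        (mul_le_mul_of_nonneg_right (hDvc_le k x) (norm_nonneg _))
    · exact (ContinuousLinearMap.le_opNorm _ _).trans
        (by rw [ContinuousLinearMap.opNorm_flip])
  have hωk : ∀ x, oc k x = fderiv ℝ (vc (k + 2)) x (e (k + 1)) - fderiv ℝ (vc (k + 1)) x (e (k + 2)) := by
    intro x
    rw [hoc]; dsimp only
    rw [homdef, curl_apply_eq_fderiv_sub_cyclic (dv x) k]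
    simp [he, hvc, EuclideanSpace.basisFun_apply]
  -- integrability for the two IBPs `∫ ∂_a v_b · h = -∫ v_b ∂_a h`
  have j1 : ∀ (b a : Fin 3), Integrable (fun x => fderiv ℝ (vc b) x (e a) * h x) volume := by
    intro b a
    refine integrable_of_le_mul_bc (((cDvc b).clm_apply continuous_const).mul ch).aestronglyMeasurable
      iDv2 iω2 hB₁0 fun x => ?_
    rw [norm_mul, Real.norm_eq_abs, Real.norm_eq_abs]
    have h1 : |fderiv ℝ (vc b) x (e a)| ≤ B₁ := by
      have := hDvc_a b x (e a); rw [he1, mul_one] at this; exact this.trans (hB₁ x)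
    calc |fderiv ℝ (vc b) x (e a)| * |h x| ≤ B₁ * (‖fderiv ℝ v x‖ * ‖om x‖) := by
          gcongr; exact hh_le x
      _ = B₁ * (‖fderiv ℝ v x‖ * ‖om x‖) := rfl
  have j2 : ∀ (b a : Fin 3), Integrable (fun x => vc b x * fderiv ℝ h x (e a)) volume := by
    intro b a
    have hm : AEStronglyMeasurable (fun x => vc b x * fderiv ℝ h x (e a)) volume :=
      ((cvc b).mul ((hh1.continuous_fderiv one_ne_zero).clm_apply continuous_const)).aestronglyMeasurable
    have hdom : Integrable (fun x => B / 2 * (‖fderiv ℝ v x‖ ^ 2 + ‖fderiv ℝ om x‖ ^ 2) +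
        B / 2 * (‖fderiv ℝ (fderiv ℝ (vc k)) x‖ ^ 2 + ‖om x‖ ^ 2)) volume :=
      ((iDv2.add iDω2).const_mul _).add ((iDDk2.add iω2).const_mul _)
    refine hdom.mono' hm (Eventually.of_forall fun x => ?_)
    rw [norm_mul, Real.norm_eq_abs, Real.norm_eq_abs]
    have h1 := hDh_le x (e a)
    rw [he1, mul_one] at h1
    have h2 : |vc b x| ≤ B := (hvc_le b x).trans (hB x)
    calc |vc b x| * |fderiv ℝ h x (e a)|
        ≤ B * (‖fderiv ℝ v x‖ * ‖fderiv ℝ om x‖ + ‖fderiv ℝ (fderiv ℝ (vc k)) x‖ * ‖om x‖) := by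
          gcongr
      _ ≤ B / 2 * (‖fderiv ℝ v x‖ ^ 2 + ‖fderiv ℝ om x‖ ^ 2) +
          B / 2 * (‖fderiv ℝ (fderiv ℝ (vc k)) x‖ ^ 2 + ‖om x‖ ^ 2) := by
          nlinarith [sq_nonneg (‖fderiv ℝ v x‖ - ‖fderiv ℝ om x‖),
            sq_nonneg (‖fderiv ℝ (fderiv ℝ (vc k)) x‖ - ‖om x‖), hB0]
  have j3 : ∀ b : Fin 3, Integrable (fun x => vc b x * h x) volume := by
    intro b
    refine integrable_of_le_mul_bc ((cvc b).mul ch).aestronglyMeasurable iDv2 iω2 hB0 fun x => ?_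
    rw [norm_mul, Real.norm_eq_abs, Real.norm_eq_abs]
    have h2 : |vc b x| ≤ B := (hvc_le b x).trans (hB x)
    calc |vc b x| * |h x| ≤ B * (‖fderiv ℝ v x‖ * ‖om x‖) := by gcongr; exact hh_le x
      _ = B * (‖fderiv ℝ v x‖ * ‖om x‖) := rfl
  have hK : ∫ x, oc k x * fderiv ℝ (vc k) x (om x) =
      (-∫ x, vc (k + 2) x * fderiv ℝ h x (e (k + 1))) + ∫ x, vc (k + 1) x * fderiv ℝ h x (e (k + 2)) := by
    have hI : ∀ x, oc k x * fderiv ℝ (vc k) x (om x) =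
        fderiv ℝ (vc (k + 2)) x (e (k + 1)) * h x - fderiv ℝ (vc (k + 1)) x (e (k + 2)) * h x := by
      intro x; rw [hωk x]; rw [hhdef]; ring
    rw [integral_congr_ae (Eventually.of_forall hI)]
    rw [integral_sub (j1 _ _) (j1 _ _)]
    have e1 : ∫ x, fderiv ℝ (vc (k + 2)) x (e (k + 1)) * h x = -∫ x, vc (k + 2) x * fderiv ℝ h x (e (k + 1)) := by
      have := ibp_bc (hvc1 (k + 2)) hh1 (e (k + 1)) (j1 _ _) (j2 _ _) (j3 _)
      rw [this, neg_neg]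
    have e2 : ∫ x, fderiv ℝ (vc (k + 1)) x (e (k + 2)) * h x = -∫ x, vc (k + 1) x * fderiv ℝ h x (e (k + 2)) := by
      have := ibp_bc (hvc1 (k + 1)) hh1 (e (k + 2)) (j1 _ _) (j2 _ _) (j3 _)
      rw [this, neg_neg]
    rw [e1, e2]; ring
  -- bound for the `i = k` term
  have hKle : ∫ x, oc k x * fderiv ℝ (vc k) x (om x) ≤
      ∫ x, (|vc (k + 1) x| + |vc (k + 2) x|) *
        (‖fderiv ℝ v x‖ * ‖fderiv ℝ om x‖ + ‖fderiv ℝ (fderiv ℝ (vc k)) x‖ * ‖om x‖) := by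
    have jn : Integrable (fun x => -(vc (k + 2) x * fderiv ℝ h x (e (k + 1)))) volume := (j2 _ _).neg
    rw [hK, ← integral_neg, ← integral_add jn (j2 (k + 1) (k + 2))]
    have iR : Integrable (fun x => (|vc (k + 1) x| + |vc (k + 2) x|) *
        (‖fderiv ℝ v x‖ * ‖fderiv ℝ om x‖ + ‖fderiv ℝ (fderiv ℝ (vc k)) x‖ * ‖om x‖)) volume := by
      have hm : AEStronglyMeasurable (fun x => (|vc (k + 1) x| + |vc (k + 2) x|) *
          (‖fderiv ℝ v x‖ * ‖fderiv ℝ om x‖ + ‖fderiv ℝ (fderiv ℝ (vc k)) x‖ * ‖om x‖)) volume :=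
        ((((cvc _).norm).add ((cvc _).norm)).mul ((cDv.norm.mul cDω.norm).add
          (cDDk.norm.mul cω.norm))).aestronglyMeasurable
      have hdom : Integrable (fun x => B * (‖fderiv ℝ v x‖ ^ 2 + ‖fderiv ℝ om x‖ ^ 2) +
          B * (‖fderiv ℝ (fderiv ℝ (vc k)) x‖ ^ 2 + ‖om x‖ ^ 2)) volume :=
        ((iDv2.add iDω2).const_mul _).add ((iDDk2.add iω2).const_mul _)
      refine hdom.mono' hm (Eventually.of_forall fun x => ?_)
      rw [Real.norm_of_nonneg (by positivity)]
      have h2 : |vc (k + 1) x| + |vc (k + 2) x| ≤ 2 * B := by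
        have := (hvc_le (k + 1) x).trans (hB x); have := (hvc_le (k + 2) x).trans (hB x); linarith
      calc (|vc (k + 1) x| + |vc (k + 2) x|) *
            (‖fderiv ℝ v x‖ * ‖fderiv ℝ om x‖ + ‖fderiv ℝ (fderiv ℝ (vc k)) x‖ * ‖om x‖)
          ≤ (2 * B) * (‖fderiv ℝ v x‖ * ‖fderiv ℝ om x‖ + ‖fderiv ℝ (fderiv ℝ (vc k)) x‖ * ‖om x‖) := by
            gcongr
        _ ≤ B * (‖fderiv ℝ v x‖ ^ 2 + ‖fderiv ℝ om x‖ ^ 2) +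
            B * (‖fderiv ℝ (fderiv ℝ (vc k)) x‖ ^ 2 + ‖om x‖ ^ 2) := by
            nlinarith [sq_nonneg (‖fderiv ℝ v x‖ - ‖fderiv ℝ om x‖),
              sq_nonneg (‖fderiv ℝ (fderiv ℝ (vc k)) x‖ - ‖om x‖), hB0]
    refine integral_mono (jn.add (j2 (k + 1) (k + 2))) iR fun x => ?_
    dsimp only
    have h1 := hDh_le x (e (k + 1))
    have h2 := hDh_le x (e (k + 2))
    rw [he1, mul_one] at h1 h2
    have a1 := abs_mul (vc (k + 2) x) (fderiv ℝ h x (e (k + 1)))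
    have a2 := abs_mul (vc (k + 1) x) (fderiv ℝ h x (e (k + 2)))
    nlinarith [neg_abs_le (vc (k + 2) x * fderiv ℝ h x (e (k + 1))),
      le_abs_self (vc (k + 1) x * fderiv ℝ h x (e (k + 2))), h1, h2, a1, a2,
      abs_nonneg (vc (k + 1) x), abs_nonneg (vc (k + 2) x),
      mul_le_mul_of_nonneg_left h1 (abs_nonneg (vc (k + 2) x)),
      mul_le_mul_of_nonneg_left h2 (abs_nonneg (vc (k + 1) x))]
  -- (4) assemble
  have iS1 : ∀ i, Integrable (fun x => oc i x * fderiv ℝ (vc i) x (om x)) volume := by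
    intro i
    refine integrable_of_le_mul_bc ((coc i).mul ((cDvc i).clm_apply cω)).aestronglyMeasurable iω2 iω2
      hB₁0 fun x => ?_
    rw [norm_mul, Real.norm_eq_abs, Real.norm_eq_abs]
    calc |oc i x| * |fderiv ℝ (vc i) x (om x)| ≤ ‖om x‖ * (‖fderiv ℝ v x‖ * ‖om x‖) := by
          gcongr
          · exact hoc_le i x
          · exact hDvc_a i x (om x)
      _ ≤ ‖om x‖ * (B₁ * ‖om x‖) := by gcongr; exact hB₁ x
      _ = B₁ * (‖om x‖ * ‖om x‖) := by ring
  have iT : ∀ i, Integrable (fun x => |vc i x| * (6 * (‖fderiv ℝ om x‖ * ‖om x‖))) volume := by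
    intro i
    refine integrable_of_le_mul_bc (((cvc i).norm).mul (continuous_const.mul (cDω.norm.mul
      cω.norm))).aestronglyMeasurable iDω2 iω2 (by positivity : (0:ℝ) ≤ 6 * B) fun x => ?_
    rw [Real.norm_of_nonneg (by positivity)]
    have h2 : |vc i x| ≤ B := (hvc_le i x).trans (hB x)
    calc |vc i x| * (6 * (‖fderiv ℝ om x‖ * ‖om x‖)) ≤ B * (6 * (‖fderiv ℝ om x‖ * ‖om x‖)) := by
          gcongr
      _ = 6 * B * (‖fderiv ℝ om x‖ * ‖om x‖) := by ring
  have iK : Integrable (fun x => (|vc (k + 1) x| + |vc (k + 2) x|) *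
      (‖fderiv ℝ v x‖ * ‖fderiv ℝ om x‖ + ‖fderiv ℝ (fderiv ℝ (vc k)) x‖ * ‖om x‖)) volume := by
    have hm : AEStronglyMeasurable (fun x => (|vc (k + 1) x| + |vc (k + 2) x|) *
        (‖fderiv ℝ v x‖ * ‖fderiv ℝ om x‖ + ‖fderiv ℝ (fderiv ℝ (vc k)) x‖ * ‖om x‖)) volume :=
      ((((cvc _).norm).add ((cvc _).norm)).mul ((cDv.norm.mul cDω.norm).add
        (cDDk.norm.mul cω.norm))).aestronglyMeasurable
    have hdom : Integrable (fun x => B * (‖fderiv ℝ v x‖ ^ 2 + ‖fderiv ℝ om x‖ ^ 2) +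
        B * (‖fderiv ℝ (fderiv ℝ (vc k)) x‖ ^ 2 + ‖om x‖ ^ 2)) volume :=
      ((iDv2.add iDω2).const_mul _).add ((iDDk2.add iω2).const_mul _)
    refine hdom.mono' hm (Eventually.of_forall fun x => ?_)
    rw [Real.norm_of_nonneg (by positivity)]
    have h2 : |vc (k + 1) x| + |vc (k + 2) x| ≤ 2 * B := by
      have := (hvc_le (k + 1) x).trans (hB x); have := (hvc_le (k + 2) x).trans (hB x); linarith
    calc (|vc (k + 1) x| + |vc (k + 2) x|) *
          (‖fderiv ℝ v x‖ * ‖fderiv ℝ om x‖ + ‖fderiv ℝ (fderiv ℝ (vc k)) x‖ * ‖om x‖)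
        ≤ (2 * B) * (‖fderiv ℝ v x‖ * ‖fderiv ℝ om x‖ + ‖fderiv ℝ (fderiv ℝ (vc k)) x‖ * ‖om x‖) := by
          gcongr
      _ ≤ B * (‖fderiv ℝ v x‖ ^ 2 + ‖fderiv ℝ om x‖ ^ 2) +
          B * (‖fderiv ℝ (fderiv ℝ (vc k)) x‖ ^ 2 + ‖om x‖ ^ 2) := by
          nlinarith [sq_nonneg (‖fderiv ℝ v x‖ - ‖fderiv ℝ om x‖),
            sq_nonneg (‖fderiv ℝ (fderiv ℝ (vc k)) x‖ - ‖om x‖), hB0]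
  -- the target integrand dominates the sum of the three bounds pointwise (equality)
  have hRHS : ∀ x, (|v x (k + 1)| + |v x (k + 2)|) *
      (6 * (‖fderiv ℝ (curl v) x‖ * ‖curl v x‖) + ‖fderiv ℝ v x‖ * ‖fderiv ℝ (curl v) x‖ +
        ‖fderiv ℝ (fderiv ℝ (fun y => v y k)) x‖ * ‖curl v x‖) =
      (|vc (k + 1) x| * (6 * (‖fderiv ℝ om x‖ * ‖om x‖)) + |vc (k + 2) x| * (6 * (‖fderiv ℝ om x‖ * ‖om x‖))) +
        (|vc (k + 1) x| + |vc (k + 2) x|) *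
          (‖fderiv ℝ v x‖ * ‖fderiv ℝ om x‖ + ‖fderiv ℝ (fderiv ℝ (vc k)) x‖ * ‖om x‖) := by
    intro x; rw [homdef, hvc]; ring
  have i23 : Integrable (fun x => oc (k + 1) x * fderiv ℝ (vc (k + 1)) x (om x) +
      oc (k + 2) x * fderiv ℝ (vc (k + 2)) x (om x)) volume := (iS1 _).add (iS1 _)
  have iTT : Integrable (fun x => |vc (k + 1) x| * (6 * (‖fderiv ℝ om x‖ * ‖om x‖)) +
      |vc (k + 2) x| * (6 * (‖fderiv ℝ om x‖ * ‖om x‖))) volume := (iT _).add (iT _)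
  rw [integral_congr_ae (Eventually.of_forall hexp), integral_congr_ae (Eventually.of_forall hRHS),
    integral_add (iS1 k) i23, integral_add (iS1 (k + 1)) (iS1 (k + 2)),
    integral_add iTT iK, integral_add (iT (k + 1)) (iT (k + 2))]
  linarith [hterm (k + 1), hterm (k + 2), hKle]

end Structure

section SecondOrder

variable {v : EuclideanSpace ℝ (Fin 3) → EuclideanSpace ℝ (Fin 3)}

/-- The derivative of a partial derivative field `W_c = ∂_c v = Dv(·)c` is `D²v(x)(c)` (Schwarz).
[folklore] -/
private theorem fderiv_fderiv_apply_const_bc (hv : ContDiff ℝ 2 v) (x c : EuclideanSpace ℝ (Fin 3)) :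
    fderiv ℝ (fun y => fderiv ℝ v y c) x = fderiv ℝ (fderiv ℝ v) x c := by
  have hD : DifferentiableAt ℝ (fderiv ℝ v) x :=
    ((hv.fderiv_right (m := 1) le_rfl).differentiable one_ne_zero) x
  have h22 : minSmoothness ℝ 2 ≤ (2 : ℕ∞ω) := by
    rw [minSmoothness_of_isRCLikeNormedField]
  have hS : ∀ a b, fderiv ℝ (fderiv ℝ v) x a b = fderiv ℝ (fderiv ℝ v) x b a := fun a b =>
    (hv.contDiffAt.isSymmSndFDerivAt h22).eq a b
  ext a
  rw [fderiv_apply_const_apply hD, hS]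

/-- `div ∂_c v = 0` for a divergence-free `v ∈ C²` (Schwarz). [folklore] -/
private theorem isDivFree_fderiv_apply_const_bc (hv : ContDiff ℝ 2 v) (hdiv : VectorCalculus.IsDivFree v)
    (c : EuclideanSpace ℝ (Fin 3)) : VectorCalculus.IsDivFree (fun y => fderiv ℝ v y c) := by
  intro x
  set e := EuclideanSpace.basisFun (Fin 3) ℝ with he
  have hD : DifferentiableAt ℝ (fderiv ℝ v) x :=
    ((hv.fderiv_right (m := 1) le_rfl).differentiable one_ne_zero) x
  rw [divergence_eq_sum_inner_fderiv e]
  have h1 : ∀ j, fderiv ℝ (fun y => fderiv ℝ v y c) x (e j) = fderiv ℝ (fderiv ℝ v) x c (e j) :=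
    fun j => by rw [fderiv_fderiv_apply_const_bc hv x c]
  simp_rw [h1]
  rw [← fderiv_sum_inner_apply_apply e hD c]
  have hzero : (fun y => ∑ j, ⟪e j, fderiv ℝ v y (e j)⟫) = fun _ => (0 : ℝ) := by
    funext y
    rw [← divergence_eq_sum_inner_fderiv e v y]
    exact hdiv y
  rw [hzero]
  simp

/-- `curl ∂_c v = ∂_c curl v` for `v ∈ C²`. [folklore] -/
private theorem curl_fderiv_apply_const_bc (hv : ContDiff ℝ 2 v) (x c : EuclideanSpace ℝ (Fin 3)) :
    curl (fun y => fderiv ℝ v y c) x = fderiv ℝ (curl v) x c := by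
  rw [curl_eq_curlCLM, fderiv_fderiv_apply_const_bc hv x c, fderiv_curl hv x]
  rfl

/-- `‖D²v(x)‖ ≤ Σ_ℓ ‖D(∂_ℓ v)(x)‖`. [folklore] -/
private theorem norm_fderiv_fderiv_le_sum_bc (hv : ContDiff ℝ 2 v) (x : EuclideanSpace ℝ (Fin 3)) :
    ‖fderiv ℝ (fderiv ℝ v) x‖ ≤
      ∑ l, ‖fderiv ℝ (fun y => fderiv ℝ v y (EuclideanSpace.basisFun (Fin 3) ℝ l)) x‖ := by
  set e := EuclideanSpace.basisFun (Fin 3) ℝ with he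
  have he1 : ∀ i, ‖e i‖ = 1 := fun i => by simp [he]
  refine ContinuousLinearMap.opNorm_le_bound _ (Finset.sum_nonneg fun l _ => norm_nonneg _) fun a => ?_
  have ha : a = ∑ l, a l • e l := ((EuclideanSpace.basisFun (Fin 3) ℝ).sum_repr a).symm
  conv_lhs => rw [ha]
  rw [map_sum, Finset.sum_mul]
  refine (norm_sum_le _ _).trans (Finset.sum_le_sum fun l _ => ?_)
  rw [map_smul, norm_smul, ← fderiv_fderiv_apply_const_bc hv x (e l), Real.norm_eq_abs, mul_comm]
  exact mul_le_mul_of_nonneg_left (abs_apply_le_norm_bc a l) (norm_nonneg _)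

/-- `‖D²v_k(x)‖ ≤ ‖D²v(x)‖` for the component `v_k`. [folklore] -/
private theorem norm_fderiv_fderiv_apply_le_bc (hv : ContDiff ℝ 2 v) (x : EuclideanSpace ℝ (Fin 3))
    (k : Fin 3) : ‖fderiv ℝ (fderiv ℝ (fun y => v y k)) x‖ ≤ ‖fderiv ℝ (fderiv ℝ v) x‖ := by
  have h1 : ‖fderiv ℝ (fderiv ℝ (fun y => v y k)) x‖ = ‖iteratedFDeriv ℝ 2 (fun y => v y k) x‖ := by
    rw [← norm_iteratedFDeriv_fderiv, norm_iteratedFDeriv_one]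
  have h1' : ‖fderiv ℝ (fderiv ℝ v) x‖ = ‖iteratedFDeriv ℝ 2 v x‖ := by
    rw [← norm_iteratedFDeriv_fderiv, norm_iteratedFDeriv_one]
  have h2 : (fun y => v y k) = (EuclideanSpace.proj k : EuclideanSpace ℝ (Fin 3) →L[ℝ] ℝ) ∘ v := rfl
  rw [h1, h1', h2, ContinuousLinearMap.iteratedFDeriv_comp_left _ hv.contDiffAt (by norm_cast)]
  refine (ContinuousLinearMap.norm_compContinuousMultilinearMap_le _ _).trans ?_
  have hP : ‖(EuclideanSpace.proj k : EuclideanSpace ℝ (Fin 3) →L[ℝ] ℝ)‖ ≤ 1 := by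
    refine ContinuousLinearMap.opNorm_le_bound _ zero_le_one fun y => ?_
    rw [one_mul, Real.norm_eq_abs]; exact abs_apply_le_norm_bc y k
  calc ‖(EuclideanSpace.proj k : EuclideanSpace ℝ (Fin 3) →L[ℝ] ℝ)‖ * ‖iteratedFDeriv ℝ 2 v x‖
      ≤ 1 * ‖iteratedFDeriv ℝ 2 v x‖ := by gcongr
    _ = ‖iteratedFDeriv ℝ 2 v x‖ := one_mul _

/-- **`‖∇²v‖_{L²}` is controlled by `‖∇ω‖_{L²}` for divergence-free `v`**:
`∫‖D²v‖² ≤ 9 ∫‖Dω‖²` (`div ∂_ℓv = 0`, `curl ∂_ℓv = ∂_ℓω`, and the tree's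
`∫|D w|²_F ≤ ∫|curl w|²` for divergence-free `w ∈ L²`). [folklore] -/
private theorem lintegral_fderiv_fderiv_sq_le_bc (hv : ContDiff ℝ 3 v) (hdiv : VectorCalculus.IsDivFree v)
    (hv1 : ∫⁻ x, ‖iteratedFDeriv ℝ 1 v x‖ₑ ^ 2 < ⊤) :
    ∫⁻ x, ‖fderiv ℝ (fderiv ℝ v) x‖ₑ ^ 2 ≤ 9 * ∫⁻ x, ‖fderiv ℝ (curl v) x‖ₑ ^ 2 := by
  set e := EuclideanSpace.basisFun (Fin 3) ℝ with he
  have he1 : ∀ i, ‖e i‖ = 1 := fun i => by simp [he]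
  have hv2 : ContDiff ℝ 2 v := hv.of_le (by norm_cast)
  set W : Fin 3 → EuclideanSpace ℝ (Fin 3) → EuclideanSpace ℝ (Fin 3) := fun l y => fderiv ℝ v y (e l) with hW
  have hW2 : ∀ l, ContDiff ℝ 2 (W l) := fun l =>
    (hv.fderiv_right (m := 2) (by norm_cast)).clm_apply contDiff_const
  have hWdiv : ∀ l, VectorCalculus.IsDivFree (W l) := fun l => isDivFree_fderiv_apply_const_bc hv2 hdiv (e l)
  have hWL2 : ∀ l, ∫⁻ x, ‖W l x‖ₑ ^ 2 < ⊤ := by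
    intro l
    refine lt_of_le_of_lt (lintegral_mono fun x => ?_) hv1
    gcongr
    rw [← ofReal_norm, ← ofReal_norm, norm_iteratedFDeriv_one]
    refine ENNReal.ofReal_le_ofReal ?_
    calc ‖W l x‖ = ‖fderiv ℝ v x (e l)‖ := rfl
      _ ≤ ‖fderiv ℝ v x‖ * ‖e l‖ := (fderiv ℝ v x).le_opNorm _
      _ = ‖fderiv ℝ v x‖ := by rw [he1, mul_one]
  -- `∫‖D W_l‖² ≤ ∫‖Dω‖²`
  have hWl : ∀ l, ∫⁻ x, ‖fderiv ℝ (W l) x‖ₑ ^ 2 ≤ ∫⁻ x, ‖fderiv ℝ (curl v) x‖ₑ ^ 2 := by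
    intro l
    calc ∫⁻ x, ‖fderiv ℝ (W l) x‖ₑ ^ 2 ≤ ∫⁻ x, ENNReal.ofReal (frobeniusNormSq (fderiv ℝ (W l) x)) := by
          refine lintegral_mono fun x => ?_
          rw [← ofReal_norm, ← ENNReal.ofReal_pow (norm_nonneg _)]
          exact ENNReal.ofReal_le_ofReal (sq_opNorm_le_frobeniusNormSq _)
      _ ≤ ∫⁻ x, ‖curl (W l) x‖ₑ ^ 2 :=
          lintegral_frobeniusNormSq_fderiv_le_lintegral_sq_norm_curl (hW2 l) (hWdiv l) (hWL2 l)
      _ ≤ ∫⁻ x, ‖fderiv ℝ (curl v) x‖ₑ ^ 2 := by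
          refine lintegral_mono fun x => ?_
          gcongr
          rw [hW]; dsimp only
          rw [curl_fderiv_apply_const_bc hv2 x (e l), ← ofReal_norm, ← ofReal_norm]
          refine ENNReal.ofReal_le_ofReal ?_
          calc ‖fderiv ℝ (curl v) x (e l)‖ ≤ ‖fderiv ℝ (curl v) x‖ * ‖e l‖ := (fderiv ℝ (curl v) x).le_opNorm _
            _ = ‖fderiv ℝ (curl v) x‖ := by rw [he1, mul_one]
  -- pointwise `‖D²v‖² ≤ 3 Σ ‖D W_l‖²`
  have hpt : ∀ x, ‖fderiv ℝ (fderiv ℝ v) x‖ₑ ^ 2 ≤ 3 * ∑ l, ‖fderiv ℝ (W l) x‖ₑ ^ 2 := by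
    intro x
    have h := norm_fderiv_fderiv_le_sum_bc hv2 x
    have h3 : ‖fderiv ℝ (fderiv ℝ v) x‖ ^ 2 ≤ 3 * ∑ l, ‖fderiv ℝ (W l) x‖ ^ 2 := by
      have hnn : 0 ≤ ‖fderiv ℝ (fderiv ℝ v) x‖ := norm_nonneg _
      calc ‖fderiv ℝ (fderiv ℝ v) x‖ ^ 2 ≤ (∑ l, ‖fderiv ℝ (W l) x‖) ^ 2 := by gcongr
        _ ≤ 3 * ∑ l, ‖fderiv ℝ (W l) x‖ ^ 2 := by
            simp only [Fin.sum_univ_three]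
            nlinarith [sq_nonneg (‖fderiv ℝ (W 0) x‖ - ‖fderiv ℝ (W 1) x‖),
              sq_nonneg (‖fderiv ℝ (W 1) x‖ - ‖fderiv ℝ (W 2) x‖),
              sq_nonneg (‖fderiv ℝ (W 0) x‖ - ‖fderiv ℝ (W 2) x‖)]
    have h4 : ENNReal.ofReal (‖fderiv ℝ (fderiv ℝ v) x‖ ^ 2) ≤
        ENNReal.ofReal (3 * ∑ l, ‖fderiv ℝ (W l) x‖ ^ 2) := ENNReal.ofReal_le_ofReal h3
    rw [ENNReal.ofReal_pow (norm_nonneg _), ofReal_norm, ENNReal.ofReal_mul (by norm_num),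
      ENNReal.ofReal_ofNat, ENNReal.ofReal_sum_of_nonneg (fun l _ => sq_nonneg _)] at h4
    refine h4.trans_eq ?_
    congr 1
    refine Finset.sum_congr rfl fun l _ => ?_
    rw [ENNReal.ofReal_pow (norm_nonneg _), ofReal_norm]
  have hmeas : ∀ l, AEMeasurable (fun x => ‖fderiv ℝ (W l) x‖ₑ ^ 2) volume := fun l =>
    (((hW2 l).continuous_fderiv (by norm_num)).aemeasurable.enorm.pow_const _)
  calc ∫⁻ x, ‖fderiv ℝ (fderiv ℝ v) x‖ₑ ^ 2 ≤ ∫⁻ x, 3 * ∑ l, ‖fderiv ℝ (W l) x‖ₑ ^ 2 := lintegral_mono hpt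
    _ = 3 * ∑ l, ∫⁻ x, ‖fderiv ℝ (W l) x‖ₑ ^ 2 := by
        rw [lintegral_const_mul' _ _ (by norm_num), lintegral_finsetSum' _ fun l _ => hmeas l]
    _ ≤ 3 * ∑ _l : Fin 3, ∫⁻ x, ‖fderiv ℝ (curl v) x‖ₑ ^ 2 :=
        mul_le_mul' le_rfl (Finset.sum_le_sum fun l _ => hWl l)
    _ = 9 * ∫⁻ x, ‖fderiv ℝ (curl v) x‖ₑ ^ 2 := by
        simp only [Finset.sum_const, Finset.card_univ, Fintype.card_fin, nsmul_eq_mul]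
        push_cast; ring

end SecondOrder

section Estimate

/-- Exponent algebra (as for Chae–Choe's Thm. 2): for `ρ > 3`, `m = 2ρ/(ρ−2)`,
`γ' = ρ/(ρ−1)`, `p₁ = 2(ρ−1)/ρ`, `q₁ = 2(ρ−1)/(ρ−2)`. [folklore] -/
private theorem bc_exponent_algebra {ρ : ℝ} (hρ : 3 < ρ) :
    let m : ℝ := 2 * ρ / (ρ - 2)
    let γ' : ℝ := ρ / (ρ - 1)
    let p₁ : ℝ := 2 * (ρ - 1) / ρ
    let q₁ : ℝ := 2 * (ρ - 1) / (ρ - 2)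
    2 < m ∧ m < 6 ∧ ρ.HolderConjugate γ' ∧ p₁.HolderConjugate q₁ ∧ 0 < γ' ∧
      γ' * p₁ = 2 ∧ γ' * q₁ = m ∧ 1 / p₁ * (1 / γ') = 1 / 2 ∧ 1 / q₁ * (1 / γ') = 1 / m ∧
      (6 - m) / (6 - 2) * (2 / m) = 1 - 3 / ρ ∧ (m - 2) / (6 - 2) * (2 / m) = 3 / ρ / 3 := by
  intro m γ' p₁ q₁
  have hρ1 : 0 < ρ - 1 := by linarith
  have hρ2 : 0 < ρ - 2 := by linarith
  have hρ0 : 0 < ρ := by linarith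
  have hm : m = 2 * ρ / (ρ - 2) := rfl
  have hγ' : γ' = ρ / (ρ - 1) := rfl
  have hp₁ : p₁ = 2 * (ρ - 1) / ρ := rfl
  have hq₁ : q₁ = 2 * (ρ - 1) / (ρ - 2) := rfl
  refine ⟨?_, ?_, ?_, ?_, ?_, ?_, ?_, ?_, ?_, ?_, ?_⟩
  · rw [hm, lt_div_iff₀ hρ2]; linarith
  · rw [hm, div_lt_iff₀ hρ2]; linarith
  · rw [Real.holderConjugate_iff]
    refine ⟨by linarith, ?_⟩
    rw [hγ']; field_simp; try ring
  · rw [Real.holderConjugate_iff]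
    refine ⟨by rw [hp₁, lt_div_iff₀ hρ0]; linarith, ?_⟩
    rw [hp₁, hq₁]; field_simp; try ring
  · rw [hγ']; positivity
  · rw [hγ', hp₁]; field_simp; try ring
  · rw [hγ', hq₁, hm]; field_simp; try ring
  · rw [hγ', hp₁]; field_simp; try ring
  · rw [hγ', hq₁, hm]; field_simp; try ring
  · rw [hm]; field_simp; try ring
  · rw [hm]; field_simp; try ring

/-- `(3 : ℝ≥0∞) < s < ∞` in real terms. [folklore] -/
private theorem toReal_three_lt_bc {γ : ℝ≥0∞} (hγ : 3 < γ) (hγtop : γ ≠ ⊤) : 3 < γ.toReal := by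
  have h : ((3 : ℝ≥0∞)).toReal < γ.toReal := (ENNReal.toReal_lt_toReal (by norm_num) hγtop).2 hγ
  rwa [ENNReal.toReal_ofNat] at h

/-- **Three-factor Hölder** `∫ f F G ≤ ‖f‖_ρ ‖F‖₂ ‖G‖_m`, `1/ρ + 1/2 + 1/m = 1`
(`m = 2ρ/(ρ−2)`), in `ℝ≥0∞`. [folklore] -/
private theorem lintegral_mul_mul_le_bc {ρ : ℝ} (hρ : 3 < ρ)
    {f F G : EuclideanSpace ℝ (Fin 3) → ℝ≥0∞} (mf : AEMeasurable f volume)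
    (mF : AEMeasurable F volume) (mG : AEMeasurable G volume) :
    ∫⁻ x, f x * (F x * G x) ≤ (∫⁻ x, f x ^ ρ) ^ (1 / ρ) *
      ((∫⁻ x, F x ^ (2 : ℝ)) ^ (1 / 2 : ℝ) * (∫⁻ x, G x ^ (2 * ρ / (ρ - 2))) ^ (1 / (2 * ρ / (ρ - 2)))) := by
  obtain ⟨h2m, hm6, hconj, hconj₁, hγ'0, hγ'p, hγ'q, he12, he1m, hexpa, hexpb⟩ :=
    bc_exponent_algebra hρ
  set m : ℝ := 2 * ρ / (ρ - 2) with hm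
  set γ' : ℝ := ρ / (ρ - 1) with hγ'def
  set p₁ : ℝ := 2 * (ρ - 1) / ρ with hp₁
  set q₁ : ℝ := 2 * (ρ - 1) / (ρ - 2) with hq₁
  have hCS : (∫⁻ x, (F x * G x) ^ γ') ^ (1 / γ') ≤
      (∫⁻ x, F x ^ (2 : ℝ)) ^ (1 / 2 : ℝ) * (∫⁻ x, G x ^ m) ^ (1 / m) := by
    have hmul : ∀ x, (F x * G x) ^ γ' = F x ^ γ' * G x ^ γ' := fun x =>
      ENNReal.mul_rpow_of_nonneg _ _ hγ'0.le
    have hpowf : ∀ y : ℝ≥0∞, (y ^ γ') ^ p₁ = y ^ (2 : ℝ) := fun y => by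
      rw [← ENNReal.rpow_mul, hγ'p]
    have hpowg : ∀ y : ℝ≥0∞, (y ^ γ') ^ q₁ = y ^ m := fun y => by
      rw [← ENNReal.rpow_mul, hγ'q]
    have hcs := ENNReal.lintegral_mul_le_Lp_mul_Lq volume hconj₁
      (f := fun x => F x ^ γ') (g := fun x => G x ^ γ') (mF.pow_const _) (mG.pow_const _)
    simp only [Pi.mul_apply, hpowf, hpowg] at hcs
    calc (∫⁻ x, (F x * G x) ^ γ') ^ (1 / γ')
        = (∫⁻ x, F x ^ γ' * G x ^ γ') ^ (1 / γ') := by rw [lintegral_congr fun x => hmul x]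
      _ ≤ ((∫⁻ x, F x ^ (2 : ℝ)) ^ (1 / p₁) * (∫⁻ x, G x ^ m) ^ (1 / q₁)) ^ (1 / γ') := by gcongr
      _ = (∫⁻ x, F x ^ (2 : ℝ)) ^ (1 / 2 : ℝ) * (∫⁻ x, G x ^ m) ^ (1 / m) := by
          rw [ENNReal.mul_rpow_of_nonneg _ _ (by positivity), ← ENNReal.rpow_mul, ← ENNReal.rpow_mul,
            he12, he1m]
  have h := ENNReal.lintegral_mul_le_Lp_mul_Lq volume hconj (f := f) (g := fun x => F x * G x) mf (mF.mul mG)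
  simp only [Pi.mul_apply] at h
  exact h.trans (mul_le_mul' le_rfl hCS)

set_option maxHeartbeats 2400000 in
/-- **The Bae–Choe estimate** (Bae–Choe 2007; Beirão da Veiga 2017, (1.10)–(1.11) and
(2.11)–(2.13): `½ d/dt‖∇u‖² + ν‖∇²u‖² ≤ c∫|ū||∇u||∇²u| ≤ c‖ū‖_p‖∇u‖_{2p/(p−2)}‖∇²u‖₂`,
"by interpolation and Sobolev's embedding theorem" `‖∇u‖_{2p/(p−2)} ≤ c‖∇u‖₂^{1−3/p}‖∇²u‖₂^{3/p}`,
"hence, by Young's inequality" `… ≤ c‖ū‖_p^q‖∇u‖²₂ + (ν/2)‖∇²u‖²₂`, `2/q + 3/p = 1`), in the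
vorticity rendering of this file. For `3 < s < ∞`, `ν > 0` and an index `k` there is
`C = C(s, ν) ≥ 0` such that every `C^∞` divergence-free field `v` on `ℝ³`, bounded with bounded
gradient, `v ∈ L²`, `∇v, ∇²v ∈ L²`, and `v_{k+1}, v_{k+2} ∈ L^s`, satisfies, with `ω = curl v`,
`2∫⟪ω, (∇v)ω⟫ ≤ ν∫|∇ω|²_F + C(‖v_{k+1}‖_s^q + ‖v_{k+2}‖_s^q)∫|ω|²`, `q = 2s/(s−3)`:
`integral_inner_curl_stretching_le_two_components`, the three-factor Hölder inequality
(`s`, `2`, `m = 2s/(s−2)`), the Calderón–Zygmund bound `‖∇v‖_m ≤ C₁‖ω‖_m`,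
`‖∇²v‖₂ ≤ 3‖∇ω‖₂` (`lintegral_fderiv_fderiv_sq_le_bc`), interpolation `2`–`6` and Sobolev for
`‖ω‖_m`, and Young's inequality with exponents `2/(1+θ)`, `2/(1−θ)`, `θ = 3/s`. The constant
is not a printed one. [cite: BeiraodaVeiga2017JMAA, §1 (1.8)–(1.11) and §2 (2.11)–(2.14) (pp. 3–6); BaeChoe2007CPDE, Thm. 1] -/
theorem exists_two_mul_integral_stretching_le_of_two_velocity_components {s : ℝ≥0∞} (hs : 3 < s)
    (hstop : s ≠ ⊤) {ν : ℝ} (hν : 0 < ν) (k : Fin 3) :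
    ∃ C : ℝ, 0 ≤ C ∧ ∀ v : EuclideanSpace ℝ (Fin 3) → EuclideanSpace ℝ (Fin 3), ContDiff ℝ ∞ v →
      VectorCalculus.IsDivFree v → eLpNorm v 2 volume < ⊤ → eLpNorm v ⊤ volume < ⊤ →
      ∀ {B : ℝ}, (∀ x, ‖v x‖ ≤ B) → ∀ {B₁ : ℝ}, (∀ x, ‖fderiv ℝ v x‖ ≤ B₁) →
      (∫⁻ x, ‖iteratedFDeriv ℝ 1 v x‖ₑ ^ 2 < ⊤) → (∫⁻ x, ‖iteratedFDeriv ℝ 2 v x‖ₑ ^ 2 < ⊤) →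
      eLpNorm (fun x => v x (k + 1)) s volume < ⊤ → eLpNorm (fun x => v x (k + 2)) s volume < ⊤ →
        2 * ∫ x, ⟪curl v x, fderiv ℝ v x (curl v x)⟫ ≤
          ν * (∫ x, frobeniusNormSq (fderiv ℝ (curl v) x)) +
            C * ((eLpNorm (fun x => v x (k + 1)) s volume).toReal ^ (2 * s.toReal / (s.toReal - 3)) +
                (eLpNorm (fun x => v x (k + 2)) s volume).toReal ^ (2 * s.toReal / (s.toReal - 3))) *
              ∫ x, ‖curl v x‖ ^ 2 := by
  set K : ℝ≥0 := SNormLESNormFDerivOfEqConst (EuclideanSpace ℝ (Fin 3))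
    (volume : Measure (EuclideanSpace ℝ (Fin 3))) 2 with hK
  set e := EuclideanSpace.basisFun (Fin 3) ℝ with he
  -- the real exponents
  have hs0 : s ≠ 0 := (lt_trans (by norm_num) hs).ne'
  set ρ : ℝ := s.toReal with hρ
  have hρ3 : 3 < ρ := toReal_three_lt_bc hs hstop
  have hρ0 : 0 < ρ := by linarith
  obtain ⟨h2m, hm6, -, -, -, -, -, -, -, hexpa, hexpb⟩ := bc_exponent_algebra hρ3
  set m : ℝ := 2 * ρ / (ρ - 2) with hm
  have hm0 : 0 < m := by linarith
  set θ : ℝ := 3 / ρ with hθ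
  have hθ0 : 0 < θ := by rw [hθ]; positivity
  have hθ1 : θ < 1 := by rw [hθ, div_lt_one hρ0]; exact hρ3
  have h1θ : 0 < 1 - θ := by linarith
  set Θ : ℝ := (1 - θ) / 2 with hΘ
  have hΘ0 : 0 < Θ := by rw [hΘ]; positivity
  have hΘ1 : Θ < 1 := by rw [hΘ]; linarith
  set q : ℝ := 2 * ρ / (ρ - 3) with hqdef
  have hqΘ : q = 1 / Θ := by
    rw [hqdef, hΘ, hθ]
    have : (ρ - 3) ≠ 0 := by linarith
    field_simp
  have hq1 : 1 ≤ q := by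
    rw [hqΘ, le_div_iff₀ hΘ0]; linarith
  have hq0 : 0 ≤ q := le_trans zero_le_one hq1
  -- the exponent `m` as an `ℝ≥0∞` and the Calderón–Zygmund constant
  set mE : ℝ≥0∞ := ENNReal.ofReal m with hmE
  have hmEr : mE.toReal = m := ENNReal.toReal_ofReal hm0.le
  have h1mE : 1 < mE := by
    rw [hmE, ← ENNReal.ofReal_one]; exact (ENNReal.ofReal_lt_ofReal_iff hm0).2 (by linarith)
  have hmE6 : mE ≤ 6 := by
    rw [hmE, show (6 : ℝ≥0∞) = ENNReal.ofReal 6 by norm_num]; exact ENNReal.ofReal_le_ofReal hm6.le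
  have hgap : 3 * (1 / mE.toReal - 1 / (6 : ℝ≥0∞).toReal) < 1 := by
    rw [hmEr, ENNReal.toReal_ofNat]
    have : 1 / m < 1 / 2 := by
      rw [div_lt_div_iff₀ hm0 (by norm_num)]; linarith
    linarith
  have hmE0 : mE ≠ 0 := (lt_trans zero_lt_one h1mE).ne'
  have hmEtop : mE ≠ ⊤ := ENNReal.ofReal_ne_top
  obtain ⟨C₁, hC₁⟩ := exists_eLpNorm_fderiv_le_curl_of_isDivFree_of_eLpNorm_lt_top
    (p := mE) (s := 6) h1mE hmE6 (by norm_num) hgap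
  -- the constants
  set c₀ : ℝ := Θ * (2 * (1 - Θ)) ^ ((1 - Θ) / Θ) * ν ^ (-((1 - Θ) / Θ)) with hc₀
  have hc₀0 : 0 ≤ c₀ := by
    rw [hc₀]
    have : 0 ≤ ν ^ (-((1 - Θ) / Θ)) := Real.rpow_nonneg hν.le _
    positivity
  set Aw : ℝ := 2 * (9 + (C₁ : ℝ)) with hAw
  have hAw0 : 0 ≤ Aw := by rw [hAw]; positivity
  set C : ℝ := c₀ * (Aw * (K : ℝ) ^ θ) ^ q * (2 : ℝ) ^ (q - 1) with hCdef
  have hC0 : 0 ≤ C := by rw [hCdef]; positivity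
  refine ⟨C, hC0, ?_⟩
  intro v hv hdiv hv2 hvtop B hB B₁ hB₁ hv1 hv2' hN1 hN2
  -- the fields and their regularity
  have hv3 : ContDiff ℝ 3 v := hv.of_le (by norm_cast)
  have hv2c : ContDiff ℝ 2 v := hv.of_le (by norm_cast)
  set om : EuclideanSpace ℝ (Fin 3) → EuclideanSpace ℝ (Fin 3) := curl v with homdef
  have hom : ContDiff ℝ ∞ om := contDiff_curl (n := ⊤) (hv.of_le (by exact_mod_cast le_top))
  have hom1 : ContDiff ℝ 1 om := hom.of_le (by norm_cast)
  have hom2 : ContDiff ℝ 2 om := hom.of_le (by norm_cast)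
  have cω : Continuous om := hom.continuous
  have cDv : Continuous (fderiv ℝ v) := hv.continuous_fderiv (by simp)
  have cDω : Continuous (fderiv ℝ om) := hom.continuous_fderiv (by simp)
  have hvm : AEStronglyMeasurable v volume := hv.continuous.aestronglyMeasurable
  set vc : Fin 3 → EuclideanSpace ℝ (Fin 3) → ℝ := fun j y => v y j with hvc
  have cvc : ∀ j, Continuous (vc j) := fun j => (contDiff_apply_bc hv j).continuous
  have cDDk : Continuous (fderiv ℝ (fderiv ℝ (vc k))) :=
    (((contDiff_apply_bc hv2c k)).fderiv_right (m := 1) (by norm_num)).continuous_fderiv one_ne_zero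
  have cDD : Continuous (fderiv ℝ (fderiv ℝ v)) :=
    ((hv2c.fderiv_right (m := 1) (by norm_num))).continuous_fderiv one_ne_zero
  -- `L²` quantities
  have l2ω : ∫⁻ x, ‖om x‖ₑ ^ 2 < ⊤ :=
    lt_of_le_of_lt (lintegral_curl_sq_le v) (ENNReal.mul_lt_top ENNReal.ofReal_lt_top hv1)
  have l2Dω : ∫⁻ x, ‖fderiv ℝ om x‖ₑ ^ 2 < ⊤ := by
    have hle : ∀ x, ‖fderiv ℝ om x‖ ≤ ‖(‖curlCLM‖) • iteratedFDeriv ℝ 2 v x‖ := fun x => by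
      rw [norm_smul, Real.norm_of_nonneg (norm_nonneg _), homdef]
      exact norm_fderiv_curl_le hv2c x
    exact lintegral_enorm_sq_lt_top_of_norm_le hle (lintegral_enorm_sq_const_smul_lt_top _ hv2')
  have i_a : Integrable (fun x => ‖om x‖ ^ 2) volume := integrable_sq_norm_of_lintegral_lt_top cω l2ω
  set a : ℝ := ∫ x, ‖om x‖ ^ 2 with ha
  have ha0 : 0 ≤ a := integral_nonneg fun x => sq_nonneg _
  have hRlt : ∫⁻ x, ENNReal.ofReal (frobeniusNormSq (fderiv ℝ om x)) < ⊤ := by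
    calc ∫⁻ x, ENNReal.ofReal (frobeniusNormSq (fderiv ℝ om x))
        ≤ ∫⁻ x, 3 * ‖fderiv ℝ om x‖ₑ ^ 2 :=
          lintegral_mono fun x => ofReal_frobeniusNormSq_le_three_mul_enorm_sq _
      _ = 3 * ∫⁻ x, ‖fderiv ℝ om x‖ₑ ^ 2 := lintegral_const_mul' _ _ (by norm_num)
      _ < ⊤ := ENNReal.mul_lt_top (by norm_num) l2Dω
  have i_R : Integrable (fun x => frobeniusNormSq (fderiv ℝ om x)) volume :=
    integrable_of_continuous_of_nonneg (continuous_frobeniusNormSq_fderiv hom1 (by simp))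
      (fun x => frobeniusNormSq_nonneg _) hRlt
  set R : ℝ := ∫ x, frobeniusNormSq (fderiv ℝ om x) with hR
  have hR0 : 0 ≤ R := integral_nonneg fun x => frobeniusNormSq_nonneg _
  have hRE : ENNReal.ofReal R = ∫⁻ x, ENNReal.ofReal (frobeniusNormSq (fderiv ℝ om x)) :=
    ofReal_integral_eq_lintegral_ofReal i_R (Eventually.of_forall fun x => frobeniusNormSq_nonneg _)
  -- `DΩ := ‖∇ω‖₂ ≤ R^{1/2}`
  set DΩ : ℝ≥0∞ := (∫⁻ x, ‖fderiv ℝ om x‖ₑ ^ (2 : ℝ)) ^ (1 / 2 : ℝ) with hDΩ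
  have hD2 : ∫⁻ x, ‖fderiv ℝ om x‖ₑ ^ (2 : ℝ) ≤ ENNReal.ofReal R := by
    rw [hRE]
    refine lintegral_mono fun x => ?_
    rw [ENNReal.rpow_two, ← ofReal_norm, ← ENNReal.ofReal_pow (norm_nonneg _)]
    exact ENNReal.ofReal_le_ofReal (sq_opNorm_le_frobeniusNormSq _)
  have hDΩ_le : DΩ ≤ ENNReal.ofReal R ^ (1 / 2 : ℝ) := by rw [hDΩ]; gcongr
  have hAE : ENNReal.ofReal a = ∫⁻ x, ‖om x‖ₑ ^ (2 : ℝ) := by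
    rw [ha, ofReal_integral_eq_lintegral_ofReal i_a (Eventually.of_forall fun x => sq_nonneg _)]
    refine lintegral_congr fun x => ?_
    rw [← ofReal_norm, ENNReal.ofReal_rpow_of_nonneg (norm_nonneg _) (by norm_num), Real.rpow_two]
  -- the norms of the two components
  set N₁ : ℝ≥0 := (eLpNorm (vc (k + 1)) s volume).toNNReal with hN₁
  set N₂ : ℝ≥0 := (eLpNorm (vc (k + 2)) s volume).toNNReal with hN₂
  have hN₁E : ((N₁ : ℝ≥0) : ℝ≥0∞) = eLpNorm (vc (k + 1)) s volume := ENNReal.coe_toNNReal hN1.ne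
  have hN₂E : ((N₂ : ℝ≥0) : ℝ≥0∞) = eLpNorm (vc (k + 2)) s volume := ENNReal.coe_toNNReal hN2.ne
  have hN₁R : (eLpNorm (vc (k + 1)) s volume).toReal = (N₁ : ℝ) := rfl
  have hN₂R : (eLpNorm (vc (k + 2)) s volume).toReal = (N₂ : ℝ) := rfl
  have hNf : ∀ j, (∫⁻ x, ‖vc j x‖ₑ ^ ρ) ^ (1 / ρ) = eLpNorm (vc j) s volume := fun j => by
    rw [eLpNorm_eq_lintegral_rpow_enorm_toReal hs0 hstop, ← hρ]
  -- Part 1: the structure estimate, as a real integral of the majorant `Φ`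
  set Φ : EuclideanSpace ℝ (Fin 3) → ℝ := fun x => (|v x (k + 1)| + |v x (k + 2)|) *
    (6 * (‖fderiv ℝ (curl v) x‖ * ‖curl v x‖) + ‖fderiv ℝ v x‖ * ‖fderiv ℝ (curl v) x‖ +
      ‖fderiv ℝ (fderiv ℝ (fun y => v y k)) x‖ * ‖curl v x‖) with hΦ
  have hΦ0 : ∀ x, 0 ≤ Φ x := fun x => by positivity
  have hS1 : ∫ x, ⟪om x, fderiv ℝ v x (om x)⟫ ≤ ∫ x, Φ x :=
    integral_inner_curl_stretching_le_two_components k hv3 hB hB₁ hv1 hv2'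
  -- `ℝ≥0∞` quantities
  set Wm : ℝ≥0∞ := (∫⁻ x, ‖om x‖ₑ ^ m) ^ (1 / m) with hWm
  set Wm2 : ℝ≥0∞ := (∫⁻ x, ‖om x‖ₑ ^ m) ^ (2 / m) with hWm2
  set Dm : ℝ≥0∞ := (∫⁻ x, ‖fderiv ℝ v x‖ₑ ^ m) ^ (1 / m) with hDm
  set DD : ℝ≥0∞ := (∫⁻ x, ‖fderiv ℝ (fderiv ℝ (vc k)) x‖ₑ ^ (2 : ℝ)) ^ (1 / 2 : ℝ) with hDD
  have hWmsq : Wm = Wm2 ^ (1 / 2 : ℝ) := by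
    rw [hWm, hWm2, ← ENNReal.rpow_mul]
    congr 1; field_simp
  -- measurability
  have mω : AEMeasurable (fun x => ‖om x‖ₑ) volume := cω.aemeasurable.enorm
  have mDv : AEMeasurable (fun x => ‖fderiv ℝ v x‖ₑ) volume := cDv.aemeasurable.enorm
  have mDω : AEMeasurable (fun x => ‖fderiv ℝ om x‖ₑ) volume := cDω.aemeasurable.enorm
  have mDD : AEMeasurable (fun x => ‖fderiv ℝ (fderiv ℝ (vc k)) x‖ₑ) volume := cDDk.aemeasurable.enorm
  have mvc : ∀ j, AEMeasurable (fun x => ‖vc j x‖ₑ) volume := fun j => (cvc j).aemeasurable.enorm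
  -- the Calderón–Zygmund inputs: `‖∇v‖_m ≤ C₁‖ω‖_m`, `‖∇²v_k‖₂ ≤ 3‖∇ω‖₂`
  have hv6 : eLpNorm v 6 volume < ⊤ :=
    (memLp_of_memLp_of_memLp_top (p := 2) (q := 6) (by norm_num) (by norm_num) ⟨hvm, hv2⟩
      ⟨hvm, hvtop⟩).eLpNorm_lt_top
  have hDm_le : Dm ≤ C₁ * Wm := by
    have h := hC₁ v hv hdiv hv6
    rw [eLpNorm_eq_lintegral_rpow_enorm_toReal hmE0 hmEtop,
      eLpNorm_eq_lintegral_rpow_enorm_toReal hmE0 hmEtop, hmEr, ← homdef] at h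
    exact h
  have hDD_le : DD ≤ 3 * DΩ := by
    have h9 := lintegral_fderiv_fderiv_sq_le_bc hv3 hdiv hv1
    rw [← homdef] at h9
    have h1 : ∫⁻ x, ‖fderiv ℝ (fderiv ℝ (vc k)) x‖ₑ ^ (2 : ℝ) ≤ 9 * ∫⁻ x, ‖fderiv ℝ om x‖ₑ ^ (2 : ℝ) := by
      have h' : ∫⁻ x, ‖fderiv ℝ (fderiv ℝ (vc k)) x‖ₑ ^ 2 ≤ ∫⁻ x, ‖fderiv ℝ (fderiv ℝ v) x‖ₑ ^ 2 := by
        refine lintegral_mono fun x => ?_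
        gcongr
        rw [← ofReal_norm, ← ofReal_norm]
        exact ENNReal.ofReal_le_ofReal (norm_fderiv_fderiv_apply_le_bc hv2c x k)
      have h'' := h'.trans h9
      simp only [← ENNReal.rpow_two] at h'' ⊢
      convert h'' using 3
    rw [hDD, hDΩ]
    calc (∫⁻ x, ‖fderiv ℝ (fderiv ℝ (vc k)) x‖ₑ ^ (2 : ℝ)) ^ (1 / 2 : ℝ)
        ≤ (9 * ∫⁻ x, ‖fderiv ℝ om x‖ₑ ^ (2 : ℝ)) ^ (1 / 2 : ℝ) := by gcongr
      _ = 3 * (∫⁻ x, ‖fderiv ℝ om x‖ₑ ^ (2 : ℝ)) ^ (1 / 2 : ℝ) := by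
          rw [ENNReal.mul_rpow_of_nonneg _ _ (by norm_num)]
          congr 1
          rw [show (9 : ℝ≥0∞) = 3 ^ (2 : ℝ) by rw [ENNReal.rpow_two]; norm_num, ← ENNReal.rpow_mul]
          norm_num
  -- the three Hölder pieces, for each component
  have hP1 : ∀ j, ∫⁻ x, ‖vc j x‖ₑ * (‖fderiv ℝ om x‖ₑ * ‖om x‖ₑ) ≤ eLpNorm (vc j) s volume * (DΩ * Wm) := by
    intro j
    have h := lintegral_mul_mul_le_bc hρ3 (mvc j) mDω mω
    rw [hNf j] at h
    exact h
  have hP2 : ∀ j, ∫⁻ x, ‖vc j x‖ₑ * (‖fderiv ℝ om x‖ₑ * ‖fderiv ℝ v x‖ₑ) ≤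
      eLpNorm (vc j) s volume * (DΩ * (C₁ * Wm)) := by
    intro j
    have h := lintegral_mul_mul_le_bc hρ3 (mvc j) mDω mDv
    rw [hNf j] at h
    exact h.trans (mul_le_mul' le_rfl (mul_le_mul' le_rfl hDm_le))
  have hP3 : ∀ j, ∫⁻ x, ‖vc j x‖ₑ * (‖fderiv ℝ (fderiv ℝ (vc k)) x‖ₑ * ‖om x‖ₑ) ≤
      eLpNorm (vc j) s volume * ((3 * DΩ) * Wm) := by
    intro j
    have h := lintegral_mul_mul_le_bc hρ3 (mvc j) mDD mω
    rw [hNf j] at h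
    exact h.trans (mul_le_mul' le_rfl (mul_le_mul' hDD_le le_rfl))
  -- the majorant in `ℝ≥0∞`
  have i_Φ : Integrable Φ volume := by
    -- `Φ` is dominated as in Part 1 (bounded factors times products of `L²` functions)
    have hB0 : 0 ≤ B := (norm_nonneg _).trans (hB 0)
    have cDDk' : Continuous fun x => ‖fderiv ℝ (fderiv ℝ (fun y => v y k)) x‖ := cDDk.norm
    have hm : AEStronglyMeasurable Φ volume := by
      refine Continuous.aestronglyMeasurable ?_
      rw [hΦ]
      exact ((continuous_abs.comp (cvc (k + 1))).add (continuous_abs.comp (cvc (k + 2)))).mul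
        (((continuous_const.mul (cDω.norm.mul cω.norm)).add (cDv.norm.mul cDω.norm)).add
          (cDDk'.mul cω.norm))
    have l2Dv : ∫⁻ x, ‖fderiv ℝ v x‖ₑ ^ 2 < ⊤ := by
      refine lt_of_le_of_lt (le_of_eq (lintegral_congr fun x => ?_)) hv1
      rw [← ofReal_norm, ← ofReal_norm, norm_iteratedFDeriv_one v]
    have l2DDk : ∫⁻ x, ‖fderiv ℝ (fderiv ℝ (vc k)) x‖ₑ ^ 2 < ⊤ := by
      have hle : ∀ x, ‖fderiv ℝ (fderiv ℝ (vc k)) x‖ ≤ ‖(1 : ℝ) • iteratedFDeriv ℝ 2 v x‖ := fun x => by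
        rw [one_smul]
        refine (norm_fderiv_fderiv_apply_le_bc hv2c x k).trans (le_of_eq ?_)
        rw [← norm_iteratedFDeriv_fderiv, norm_iteratedFDeriv_one]
      exact lintegral_enorm_sq_lt_top_of_norm_le hle (lintegral_enorm_sq_const_smul_lt_top _ hv2')
    have iDv2 : Integrable (fun x => ‖fderiv ℝ v x‖ ^ 2) volume :=
      integrable_sq_norm_of_lintegral_lt_top cDv l2Dv
    have iDω2 : Integrable (fun x => ‖fderiv ℝ om x‖ ^ 2) volume :=
      integrable_sq_norm_of_lintegral_lt_top cDω l2Dω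
    have iDDk2 : Integrable (fun x => ‖fderiv ℝ (fderiv ℝ (vc k)) x‖ ^ 2) volume :=
      integrable_sq_norm_of_lintegral_lt_top cDDk l2DDk
    have hdom : Integrable (fun x => 6 * B * (‖fderiv ℝ om x‖ ^ 2 + ‖om x‖ ^ 2) +
        B * (‖fderiv ℝ v x‖ ^ 2 + ‖fderiv ℝ om x‖ ^ 2) +
        B * (‖fderiv ℝ (fderiv ℝ (vc k)) x‖ ^ 2 + ‖om x‖ ^ 2)) volume :=
      (((iDω2.add i_a).const_mul _).add ((iDv2.add iDω2).const_mul _)).add ((iDDk2.add i_a).const_mul _)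
    refine hdom.mono' hm (Eventually.of_forall fun x => ?_)
    rw [Real.norm_of_nonneg (hΦ0 x), hΦ]
    dsimp only
    have h2 : |v x (k + 1)| + |v x (k + 2)| ≤ 2 * B := by
      have := (abs_apply_le_norm_bc (v x) (k + 1)).trans (hB x)
      have := (abs_apply_le_norm_bc (v x) (k + 2)).trans (hB x); linarith
    rw [← homdef]
    have hω0 := norm_nonneg (om x)
    have hDω0 := norm_nonneg (fderiv ℝ om x)
    have hDv0 := norm_nonneg (fderiv ℝ v x)
    have hDD0 := norm_nonneg (fderiv ℝ (fderiv ℝ (vc k)) x)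
    have hvk : (fun y => v y k) = vc k := rfl
    rw [hvk]
    calc (|v x (k + 1)| + |v x (k + 2)|) *
          (6 * (‖fderiv ℝ om x‖ * ‖om x‖) + ‖fderiv ℝ v x‖ * ‖fderiv ℝ om x‖ +
            ‖fderiv ℝ (fderiv ℝ (vc k)) x‖ * ‖om x‖)
        ≤ (2 * B) * (6 * (‖fderiv ℝ om x‖ * ‖om x‖) + ‖fderiv ℝ v x‖ * ‖fderiv ℝ om x‖ +
            ‖fderiv ℝ (fderiv ℝ (vc k)) x‖ * ‖om x‖) := by gcongr
      _ ≤ 6 * B * (‖fderiv ℝ om x‖ ^ 2 + ‖om x‖ ^ 2) + B * (‖fderiv ℝ v x‖ ^ 2 + ‖fderiv ℝ om x‖ ^ 2) +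
          B * (‖fderiv ℝ (fderiv ℝ (vc k)) x‖ ^ 2 + ‖om x‖ ^ 2) := by
          nlinarith [sq_nonneg (‖fderiv ℝ om x‖ - ‖om x‖), sq_nonneg (‖fderiv ℝ v x‖ - ‖fderiv ℝ om x‖),
            sq_nonneg (‖fderiv ℝ (fderiv ℝ (vc k)) x‖ - ‖om x‖), hB0]
  have hpt : ∀ x, ENNReal.ofReal (Φ x) =
      (‖vc (k + 1) x‖ₑ + ‖vc (k + 2) x‖ₑ) *
        (6 * (‖fderiv ℝ om x‖ₑ * ‖om x‖ₑ) + ‖fderiv ℝ om x‖ₑ * ‖fderiv ℝ v x‖ₑ +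
          ‖fderiv ℝ (fderiv ℝ (vc k)) x‖ₑ * ‖om x‖ₑ) := by
    intro x
    rw [hΦ]
    dsimp only
    rw [← homdef, show (fun y => v y k) = vc k from rfl,
      ENNReal.ofReal_mul (by positivity), ENNReal.ofReal_add (abs_nonneg _) (abs_nonneg _),
      ENNReal.ofReal_add (by positivity) (by positivity), ENNReal.ofReal_add (by positivity) (by positivity),
      ENNReal.ofReal_mul (by norm_num), ENNReal.ofReal_mul (norm_nonneg _),
      ENNReal.ofReal_mul (norm_nonneg _), ENNReal.ofReal_mul (norm_nonneg _), ENNReal.ofReal_ofNat]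
    have e1 : ENNReal.ofReal |v x (k + 1)| = ‖vc (k + 1) x‖ₑ := by
      rw [← Real.norm_eq_abs, ofReal_norm]
    have e2 : ENNReal.ofReal |v x (k + 2)| = ‖vc (k + 2) x‖ₑ := by
      rw [← Real.norm_eq_abs, ofReal_norm]
    rw [e1, e2]
    simp only [ofReal_norm]
    ring
  have hsum : ENNReal.ofReal (∫ x, Φ x) ≤ ((N₁ : ℝ≥0∞) + N₂) * ((9 + (C₁ : ℝ≥0∞)) * (DΩ * Wm)) := by
    rw [ofReal_integral_eq_lintegral_ofReal i_Φ (Eventually.of_forall hΦ0)]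
    -- split the integrand into the six pieces
    have hsplit : ∀ x, ENNReal.ofReal (Φ x) =
        (6 * (‖vc (k + 1) x‖ₑ * (‖fderiv ℝ om x‖ₑ * ‖om x‖ₑ)) +
          (‖vc (k + 1) x‖ₑ * (‖fderiv ℝ om x‖ₑ * ‖fderiv ℝ v x‖ₑ) +
            ‖vc (k + 1) x‖ₑ * (‖fderiv ℝ (fderiv ℝ (vc k)) x‖ₑ * ‖om x‖ₑ))) +
        (6 * (‖vc (k + 2) x‖ₑ * (‖fderiv ℝ om x‖ₑ * ‖om x‖ₑ)) +
          (‖vc (k + 2) x‖ₑ * (‖fderiv ℝ om x‖ₑ * ‖fderiv ℝ v x‖ₑ) +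
            ‖vc (k + 2) x‖ₑ * (‖fderiv ℝ (fderiv ℝ (vc k)) x‖ₑ * ‖om x‖ₑ))) := fun x => by
      rw [hpt x]; ring
    have mA : ∀ j, AEMeasurable (fun x => 6 * (‖vc j x‖ₑ * (‖fderiv ℝ om x‖ₑ * ‖om x‖ₑ))) volume :=
      fun j => ((mvc j).mul (mDω.mul mω)).const_mul _
    have mB : ∀ j, AEMeasurable (fun x => ‖vc j x‖ₑ * (‖fderiv ℝ om x‖ₑ * ‖fderiv ℝ v x‖ₑ)) volume :=
      fun j => (mvc j).mul (mDω.mul mDv)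
    have mC : ∀ j, AEMeasurable (fun x => ‖vc j x‖ₑ * (‖fderiv ℝ (fderiv ℝ (vc k)) x‖ₑ * ‖om x‖ₑ)) volume :=
      fun j => (mvc j).mul (mDD.mul mω)
    have mBC : ∀ j, AEMeasurable (fun x => ‖vc j x‖ₑ * (‖fderiv ℝ om x‖ₑ * ‖fderiv ℝ v x‖ₑ) +
        ‖vc j x‖ₑ * (‖fderiv ℝ (fderiv ℝ (vc k)) x‖ₑ * ‖om x‖ₑ)) volume := fun j => (mB j).add (mC j)
    have mABC : ∀ j, AEMeasurable (fun x => 6 * (‖vc j x‖ₑ * (‖fderiv ℝ om x‖ₑ * ‖om x‖ₑ)) +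
        (‖vc j x‖ₑ * (‖fderiv ℝ om x‖ₑ * ‖fderiv ℝ v x‖ₑ) +
          ‖vc j x‖ₑ * (‖fderiv ℝ (fderiv ℝ (vc k)) x‖ₑ * ‖om x‖ₑ))) volume := fun j => (mA j).add (mBC j)
    have hgroup : ∀ j, ∫⁻ x, (6 * (‖vc j x‖ₑ * (‖fderiv ℝ om x‖ₑ * ‖om x‖ₑ)) +
        (‖vc j x‖ₑ * (‖fderiv ℝ om x‖ₑ * ‖fderiv ℝ v x‖ₑ) +
          ‖vc j x‖ₑ * (‖fderiv ℝ (fderiv ℝ (vc k)) x‖ₑ * ‖om x‖ₑ))) ≤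
        eLpNorm (vc j) s volume * ((9 + (C₁ : ℝ≥0∞)) * (DΩ * Wm)) := by
      intro j
      rw [lintegral_add_left' (mA j), lintegral_add_left' (mB j), lintegral_const_mul' _ _ (by norm_num)]
      calc 6 * (∫⁻ x, ‖vc j x‖ₑ * (‖fderiv ℝ om x‖ₑ * ‖om x‖ₑ)) +
            ((∫⁻ x, ‖vc j x‖ₑ * (‖fderiv ℝ om x‖ₑ * ‖fderiv ℝ v x‖ₑ)) +
              ∫⁻ x, ‖vc j x‖ₑ * (‖fderiv ℝ (fderiv ℝ (vc k)) x‖ₑ * ‖om x‖ₑ))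
          ≤ 6 * (eLpNorm (vc j) s volume * (DΩ * Wm)) +
            (eLpNorm (vc j) s volume * (DΩ * (C₁ * Wm)) + eLpNorm (vc j) s volume * ((3 * DΩ) * Wm)) :=
            add_le_add (mul_le_mul' le_rfl (hP1 j)) (add_le_add (hP2 j) (hP3 j))
        _ = eLpNorm (vc j) s volume * ((9 + (C₁ : ℝ≥0∞)) * (DΩ * Wm)) := by ring
    calc ∫⁻ x, ENNReal.ofReal (Φ x)
        = ∫⁻ x, ((6 * (‖vc (k + 1) x‖ₑ * (‖fderiv ℝ om x‖ₑ * ‖om x‖ₑ)) +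
          (‖vc (k + 1) x‖ₑ * (‖fderiv ℝ om x‖ₑ * ‖fderiv ℝ v x‖ₑ) +
            ‖vc (k + 1) x‖ₑ * (‖fderiv ℝ (fderiv ℝ (vc k)) x‖ₑ * ‖om x‖ₑ))) +
        (6 * (‖vc (k + 2) x‖ₑ * (‖fderiv ℝ om x‖ₑ * ‖om x‖ₑ)) +
          (‖vc (k + 2) x‖ₑ * (‖fderiv ℝ om x‖ₑ * ‖fderiv ℝ v x‖ₑ) +
            ‖vc (k + 2) x‖ₑ * (‖fderiv ℝ (fderiv ℝ (vc k)) x‖ₑ * ‖om x‖ₑ)))) := lintegral_congr hsplit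
      _ = (∫⁻ x, (6 * (‖vc (k + 1) x‖ₑ * (‖fderiv ℝ om x‖ₑ * ‖om x‖ₑ)) +
          (‖vc (k + 1) x‖ₑ * (‖fderiv ℝ om x‖ₑ * ‖fderiv ℝ v x‖ₑ) +
            ‖vc (k + 1) x‖ₑ * (‖fderiv ℝ (fderiv ℝ (vc k)) x‖ₑ * ‖om x‖ₑ)))) +
          ∫⁻ x, (6 * (‖vc (k + 2) x‖ₑ * (‖fderiv ℝ om x‖ₑ * ‖om x‖ₑ)) +
          (‖vc (k + 2) x‖ₑ * (‖fderiv ℝ om x‖ₑ * ‖fderiv ℝ v x‖ₑ) +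
            ‖vc (k + 2) x‖ₑ * (‖fderiv ℝ (fderiv ℝ (vc k)) x‖ₑ * ‖om x‖ₑ))) := lintegral_add_left' (mABC _) _
      _ ≤ eLpNorm (vc (k + 1)) s volume * ((9 + (C₁ : ℝ≥0∞)) * (DΩ * Wm)) +
          eLpNorm (vc (k + 2)) s volume * ((9 + (C₁ : ℝ≥0∞)) * (DΩ * Wm)) := add_le_add (hgroup _) (hgroup _)
      _ = ((N₁ : ℝ≥0∞) + N₂) * ((9 + (C₁ : ℝ≥0∞)) * (DΩ * Wm)) := by rw [← hN₁E, ← hN₂E]; ring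
  -- interpolation `2`–`6` and Sobolev: `‖ω‖_m ≤ (a^{1-θ} (K² R)^θ)^{1/2}`
  have l2ωE : eLpNorm om 2 volume < ⊤ := eLpNorm_two_lt_top_of_lintegral_enorm_sq_lt_top l2ω
  have hSob : eLpNorm om 6 volume ≤ K * eLpNorm (fderiv ℝ om) 2 volume :=
    eLpNorm_six_le_eLpNorm_fderiv_two volume finrank_euclideanSpace_fin hom1 l2ωE
  have hD : eLpNorm (fderiv ℝ om) 2 volume ^ 2 ≤ ENNReal.ofReal R := by
    rw [← lintegral_enorm_sq_eq_eLpNorm_two_sq, hRE]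
    refine lintegral_mono fun x => ?_
    rw [← ofReal_norm, ← ENNReal.ofReal_pow (norm_nonneg _)]
    exact ENNReal.ofReal_le_ofReal (sq_opNorm_le_frobeniusNormSq _)
  have hS6 : ∫⁻ x, ‖om x‖ₑ ^ (6 : ℝ) ≤ ((K : ℝ≥0∞) ^ 2 * ENNReal.ofReal R) ^ (3 : ℝ) := by
    have h6 : ∫⁻ x, ‖om x‖ₑ ^ (6 : ℝ) = eLpNorm om 6 volume ^ (6 : ℝ) := by
      rw [eLpNorm_eq_lintegral_rpow_enorm_toReal (by norm_num) (by norm_num), ENNReal.toReal_ofNat,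
        ← ENNReal.rpow_mul]
      norm_num
    rw [h6]
    calc eLpNorm om 6 volume ^ (6 : ℝ) ≤ (K * eLpNorm (fderiv ℝ om) 2 volume) ^ (6 : ℝ) := by gcongr
      _ = ((K : ℝ≥0∞) ^ 2 * eLpNorm (fderiv ℝ om) 2 volume ^ 2) ^ (3 : ℝ) := by
          rw [← mul_pow, ← ENNReal.rpow_natCast, ← ENNReal.rpow_mul]; norm_num
      _ ≤ ((K : ℝ≥0∞) ^ 2 * ENNReal.ofReal R) ^ (3 : ℝ) := by gcongr
  have hInterp : ∫⁻ x, ‖om x‖ₑ ^ m ≤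
      (∫⁻ x, ‖om x‖ₑ ^ (2 : ℝ)) ^ ((6 - m) / (6 - 2)) * (∫⁻ x, ‖om x‖ₑ ^ (6 : ℝ)) ^ ((m - 2) / (6 - 2)) :=
    lintegral_rpow_interpolate cω.aemeasurable.enorm zero_lt_two (by norm_num) h2m.le hm6.le
  have hθ3 : (3 : ℝ) * (3 / ρ / 3) = θ := by rw [hθ]; ring
  have hWm2_le : Wm2 ≤ ENNReal.ofReal a ^ (1 - θ) * ((K : ℝ≥0∞) ^ 2 * ENNReal.ofReal R) ^ θ := by
    rw [hWm2]
    calc (∫⁻ x, ‖om x‖ₑ ^ m) ^ (2 / m)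
        ≤ ((∫⁻ x, ‖om x‖ₑ ^ (2 : ℝ)) ^ ((6 - m) / (6 - 2)) *
            (∫⁻ x, ‖om x‖ₑ ^ (6 : ℝ)) ^ ((m - 2) / (6 - 2))) ^ (2 / m) := by gcongr
      _ = (∫⁻ x, ‖om x‖ₑ ^ (2 : ℝ)) ^ (1 - θ) * ((∫⁻ x, ‖om x‖ₑ ^ (6 : ℝ)) ^ (3 / ρ / 3)) := by
          rw [ENNReal.mul_rpow_of_nonneg _ _ (by positivity), ← ENNReal.rpow_mul,
            ← ENNReal.rpow_mul, hexpa, hexpb, hθ]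
      _ ≤ (∫⁻ x, ‖om x‖ₑ ^ (2 : ℝ)) ^ (1 - θ) *
            ((((K : ℝ≥0∞) ^ 2 * ENNReal.ofReal R) ^ (3 : ℝ)) ^ (3 / ρ / 3)) := by gcongr
      _ = ENNReal.ofReal a ^ (1 - θ) * ((K : ℝ≥0∞) ^ 2 * ENNReal.ofReal R) ^ θ := by
          rw [hAE, ← ENNReal.rpow_mul, hθ3]
  have hWm_le : Wm ≤ (ENNReal.ofReal a ^ (1 - θ) * ((K : ℝ≥0∞) ^ 2 * ENNReal.ofReal R) ^ θ) ^ (1 / 2 : ℝ) := by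
    rw [hWmsq]; gcongr
  -- back to the reals
  have hfin : ((N₁ : ℝ≥0∞) + N₂) * ((9 + (C₁ : ℝ≥0∞)) * (ENNReal.ofReal R ^ (1 / 2 : ℝ) *
      (ENNReal.ofReal a ^ (1 - θ) * ((K : ℝ≥0∞) ^ 2 * ENNReal.ofReal R) ^ θ) ^ (1 / 2 : ℝ))) ≠ ⊤ := by
    refine ENNReal.mul_ne_top (by simp) (ENNReal.mul_ne_top (by simp) (ENNReal.mul_ne_top ?_ ?_))
    · exact ENNReal.rpow_ne_top_of_nonneg (by norm_num) ENNReal.ofReal_ne_top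
    · refine ENNReal.rpow_ne_top_of_nonneg (by norm_num) (ENNReal.mul_ne_top ?_ ?_)
      · exact ENNReal.rpow_ne_top_of_nonneg h1θ.le ENNReal.ofReal_ne_top
      · exact ENNReal.rpow_ne_top_of_nonneg hθ0.le
          (ENNReal.mul_ne_top (ENNReal.pow_ne_top ENNReal.coe_ne_top) ENNReal.ofReal_ne_top)
  have hgR : ∫ x, Φ x ≤ ((N₁ : ℝ) + N₂) * ((9 + (C₁ : ℝ)) * (R ^ (1 / 2 : ℝ) *
      (a ^ (1 - θ) * ((K : ℝ) ^ 2 * R) ^ θ) ^ (1 / 2 : ℝ))) := by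
    have h1 : ENNReal.ofReal (∫ x, Φ x) ≤ ((N₁ : ℝ≥0∞) + N₂) * ((9 + (C₁ : ℝ≥0∞)) *
        (ENNReal.ofReal R ^ (1 / 2 : ℝ) *
          (ENNReal.ofReal a ^ (1 - θ) * ((K : ℝ≥0∞) ^ 2 * ENNReal.ofReal R) ^ θ) ^ (1 / 2 : ℝ))) :=
      hsum.trans (mul_le_mul' le_rfl (mul_le_mul' le_rfl (mul_le_mul' hDΩ_le hWm_le)))
    have h2 := (ENNReal.ofReal_le_iff_le_toReal hfin).1 h1
    refine h2.trans_eq ?_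
    rw [ENNReal.toReal_mul, ENNReal.toReal_mul, ENNReal.toReal_mul, ← ENNReal.toReal_rpow,
      ← ENNReal.toReal_rpow, ENNReal.toReal_mul, ← ENNReal.toReal_rpow, ← ENNReal.toReal_rpow,
      ENNReal.toReal_mul, ENNReal.toReal_pow, ENNReal.toReal_ofReal ha0,
      ENNReal.toReal_ofReal hR0, ENNReal.toReal_add ENNReal.coe_ne_top ENNReal.coe_ne_top,
      ENNReal.toReal_add (by norm_num) ENNReal.coe_ne_top,
      ENNReal.coe_toReal, ENNReal.coe_toReal, ENNReal.coe_toReal, ENNReal.coe_toReal, ENNReal.toReal_ofNat]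
  -- rearrangement: `R^{1/2} (a^{1-θ} (K²R)^θ)^{1/2} = K^θ a^Θ R^{1-Θ}`
  have hK0 : 0 ≤ (K : ℝ) := K.2
  have hsplit : R ^ (1 / 2 : ℝ) * (a ^ (1 - θ) * ((K : ℝ) ^ 2 * R) ^ θ) ^ (1 / 2 : ℝ) =
      (K : ℝ) ^ θ * (a ^ Θ * R ^ (1 - Θ)) := by
    rw [Real.mul_rpow (by positivity) (by positivity), ← Real.rpow_mul ha0,
      Real.mul_rpow (by positivity) hR0, Real.mul_rpow (by positivity) (by positivity),
      ← Real.rpow_mul hR0, ← Real.rpow_natCast (K : ℝ) 2, ← Real.rpow_mul hK0, ← Real.rpow_mul hK0]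
    have e1 : (1 - θ) * (1 / 2 : ℝ) = Θ := by rw [hΘ]; ring
    have e2 : ((2 : ℕ) : ℝ) * θ * (1 / 2 : ℝ) = θ := by push_cast; ring
    rw [e1, e2]
    have e3 : R ^ (1 / 2 : ℝ) * R ^ (θ * (1 / 2 : ℝ)) = R ^ (1 - Θ) := by
      rw [← Real.rpow_add' hR0]
      · congr 1; rw [hΘ]; ring
      · have : 0 < 1 / 2 + θ * (1 / 2 : ℝ) := by positivity
        exact this.ne'
    calc R ^ (1 / 2 : ℝ) * (a ^ Θ * ((K : ℝ) ^ θ * R ^ (θ * (1 / 2 : ℝ))))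
        = (K : ℝ) ^ θ * (a ^ Θ * (R ^ (1 / 2 : ℝ) * R ^ (θ * (1 / 2 : ℝ)))) := by ring
      _ = (K : ℝ) ^ θ * (a ^ Θ * R ^ (1 - Θ)) := by rw [e3]
  set Nr : ℝ := (N₁ : ℝ) + N₂ with hNr
  have hNr0 : 0 ≤ Nr := by positivity
  have hC₁0 : 0 ≤ (C₁ : ℝ) := C₁.2
  set A₀ : ℝ := Aw * (K : ℝ) ^ θ * Nr with hA₀
  have hA₀0 : 0 ≤ A₀ := by positivity
  have h2g : 2 * ∫ x, Φ x ≤ A₀ * a ^ Θ * R ^ (1 - Θ) := by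
    have := hgR
    rw [hsplit] at this
    calc 2 * ∫ x, Φ x ≤ 2 * (Nr * ((9 + (C₁ : ℝ)) * ((K : ℝ) ^ θ * (a ^ Θ * R ^ (1 - Θ))))) := by
          linarith
      _ = A₀ * a ^ Θ * R ^ (1 - Θ) := by rw [hA₀, hAw]; ring
  -- Young's inequality
  have hyoung : 2 * ∫ x, Φ x ≤ ν / 2 * R + c₀ * A₀ ^ (1 / Θ) * a := by
    have h2 := mul_rpow_mul_rpow_le_absorb hΘ0 hΘ1 hν (a := A₀) (x := R) (y := a) hA₀0 hR0 ha0
    rw [hc₀]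
    linarith [h2g, h2]
  -- the constant: `A₀^q = (Aw K^θ)^q Nr^q ≤ (Aw K^θ)^q 2^{q-1} (N₁^q + N₂^q)`
  have hconv : Nr ^ q ≤ (2 : ℝ) ^ (q - 1) * ((N₁ : ℝ) ^ q + (N₂ : ℝ) ^ q) := by
    have h := NNReal.rpow_add_le_mul_rpow_add_rpow N₁ N₂ hq1
    have h' := NNReal.coe_le_coe.2 h
    push_cast at h'
    rw [hNr]
    exact h'
  have hA₀q : A₀ ^ (1 / Θ) ≤ (Aw * (K : ℝ) ^ θ) ^ q * ((2 : ℝ) ^ (q - 1) * ((N₁ : ℝ) ^ q + (N₂ : ℝ) ^ q)) := by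
    rw [← hqΘ, hA₀, Real.mul_rpow (by positivity) hNr0]
    exact mul_le_mul_of_nonneg_left hconv (by positivity)
  -- conclusion
  have hmain : 2 * ∫ x, Φ x ≤ ν * R + C * (((N₁ : ℝ) ^ q + (N₂ : ℝ) ^ q)) * a := by
    have h3 : c₀ * A₀ ^ (1 / Θ) * a ≤
        c₀ * ((Aw * (K : ℝ) ^ θ) ^ q * ((2 : ℝ) ^ (q - 1) * ((N₁ : ℝ) ^ q + (N₂ : ℝ) ^ q))) * a := by
      gcongr
    have hνR : ν / 2 * R ≤ ν * R := by nlinarith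
    rw [hCdef]
    nlinarith [hyoung, h3, ha0, hνR]
  calc 2 * ∫ x, ⟪om x, fderiv ℝ v x (om x)⟫ ≤ 2 * ∫ x, Φ x := by linarith [hS1]
    _ ≤ ν * R + C * (((N₁ : ℝ) ^ q + (N₂ : ℝ) ^ q)) * a := hmain
    _ = ν * R + C * ((eLpNorm (vc (k + 1)) s volume).toReal ^ q +
            (eLpNorm (vc (k + 2)) s volume).toReal ^ q) * a := by
        rw [hN₁R, hN₂R]

end Estimate

section Criterion

/-- **Exponent bookkeeping**: in `ℝ≥0∞`, if `3 < γ < ∞` and `2/α + 3/γ = 1` then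
`0 < α < ∞` and `α.toReal = 2γ/(γ − 3)`. [folklore] -/
private theorem bc_exponents {α γ : ℝ≥0∞} (hγ : 3 < γ) (hγtop : γ ≠ ⊤) (hαγ : 2 / α + 3 / γ = 1) :
    α ≠ 0 ∧ α ≠ ⊤ ∧ α.toReal = 2 * γ.toReal / (γ.toReal - 3) := by
  have hγ0 : γ ≠ 0 := (lt_trans (by norm_num) hγ).ne'
  have hρ3 : 3 < γ.toReal := toReal_three_lt_bc hγ hγtop
  have hρ0 : 0 < γ.toReal := by linarith
  have hα0 : α ≠ 0 := by
    rintro rfl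
    rw [ENNReal.div_zero (by norm_num : (2 : ℝ≥0∞) ≠ 0), top_add] at hαγ
    exact absurd hαγ ENNReal.top_ne_one
  have h2α : 2 / α ≠ ⊤ := ENNReal.div_ne_top (by norm_num) hα0
  have h3γ : 3 / γ ≠ ⊤ := ENNReal.div_ne_top (by norm_num) hγ0
  have hreal : 2 / α.toReal + 3 / γ.toReal = 1 := by
    have h := congrArg ENNReal.toReal hαγ
    rw [ENNReal.toReal_add h2α h3γ, ENNReal.toReal_div, ENNReal.toReal_div, ENNReal.toReal_ofNat,
      ENNReal.toReal_ofNat] at h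
    simpa using h
  have hαtop : α ≠ ⊤ := by
    intro hα
    rw [hα, ENNReal.toReal_top, div_zero, zero_add, div_eq_one_iff_eq hρ0.ne'] at hreal
    linarith
  have ha0 : 0 < α.toReal := ENNReal.toReal_pos hα0 hαtop
  refine ⟨hα0, hαtop, ?_⟩
  have hρ3' : 0 < γ.toReal - 3 := by linarith
  have h : 2 / α.toReal = (γ.toReal - 3) / γ.toReal := by
    rw [sub_div, div_self hρ0.ne']; linarith
  have h' : α.toReal = 2 / ((γ.toReal - 3) / γ.toReal) := by
    rw [← h]; field_simp
  rw [h', div_div_eq_mul_div]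

/-- `L^q_t L^r_x` data: the lower time integral of `‖G(t)‖_{L^r}^{q}` (real exponent `q.toReal`)
is finite and `G(t) ∈ L^r` for a.e. `t` (unfolding `MemLqLp`). [folklore] -/
private theorem lintegral_ofReal_toReal_rpow_lt_top_bc {X F : Type*} [MeasureSpace X] [NormedAddCommGroup F]
    {q r : ℝ≥0∞} {G : ℝ → X → F} {T : ℝ} (hq0 : q ≠ 0) (hqtop : q ≠ ⊤)
    (hS : MemLqLp q r G (Ioo 0 T)) :
    (∫⁻ t in Ioo 0 T, ENNReal.ofReal ((eLpNorm (G t) r volume).toReal ^ q.toReal) < ⊤) ∧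
    ∀ᵐ t ∂volume, t ∈ Ioo 0 T → eLpNorm (G t) r volume < ⊤ := by
  set N : ℝ → ℝ := fun t => (eLpNorm (G t) r volume).toReal with hN
  have hN0 : ∀ t, 0 ≤ N t := fun t => ENNReal.toReal_nonneg
  refine ⟨?_, ?_⟩
  · have hlt : ∫⁻ t, ‖N t‖ₑ ^ q.toReal ∂(volume.restrict (Ioo 0 T)) < ⊤ :=
      lintegral_rpow_enorm_lt_top_of_eLpNorm_lt_top hq0 hqtop hS.2
    refine lt_of_le_of_lt (le_of_eq (lintegral_congr fun t => ?_)) hlt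
    rw [Real.enorm_eq_ofReal (hN0 t), ENNReal.ofReal_rpow_of_nonneg (hN0 t) ENNReal.toReal_nonneg]
  · have h := hS.1
    rw [ae_restrict_iff' measurableSet_Ioo] at h
    filter_upwards [h] with t ht htI
    exact (ht htI).eLpNorm_lt_top

/-- Time measurability of the `L^γ` norms of the velocity components `u_j(t)` of a classical
solution on `(0, T)`, `0 < γ < ∞` (joint continuity of `u` on `(0,T) × ℝ³` and Tonelli).
[folklore] -/
private theorem aemeasurable_eLpNorm_apply_bc {ν T : ℝ}
    {u : ℝ → (EuclideanSpace ℝ (Fin 3)) → (EuclideanSpace ℝ (Fin 3))}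
    {p : ℝ → (EuclideanSpace ℝ (Fin 3)) → ℝ} (hsol : IsClassicalNSSolutionOn (Ico 0 T) ν 0 u p)
    {γ : ℝ≥0∞} (hγ0 : γ ≠ 0) (hγtop : γ ≠ ⊤) (j : Fin 3) :
    AEMeasurable (fun t => eLpNorm (fun x => u t x j) γ volume) (volume.restrict (Ioo 0 T)) := by
  have hcD : ContinuousOn (fun z : ℝ × EuclideanSpace ℝ (Fin 3) => u z.1 z.2) (Ioo 0 T ×ˢ univ) :=
    hsol.smooth_velocity.continuousOn.mono (prod_mono Ioo_subset_Ico_self Subset.rfl)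
  have hmeasD : AEStronglyMeasurable (fun z : ℝ × EuclideanSpace ℝ (Fin 3) => u z.1 z.2)
      ((volume.restrict (Ioo 0 T)).prod volume) := by
    rw [Measure.restrict_prod_eq_prod_univ]
    exact hcD.aestronglyMeasurable (measurableSet_Ioo.prod MeasurableSet.univ)
  have hmj : AEStronglyMeasurable (fun z : ℝ × EuclideanSpace ℝ (Fin 3) => u z.1 z.2 j)
      ((volume.restrict (Ioo 0 T)).prod volume) :=
    (EuclideanSpace.proj j).continuous.comp_aestronglyMeasurable hmeasD
  have hGI : AEMeasurable (fun t => ∫⁻ x, ‖u t x j‖ₑ ^ γ.toReal) (volume.restrict (Ioo 0 T)) :=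
    (hmj.enorm.pow_const _).lintegral_prod_right'
  have heq : (fun t => eLpNorm (fun x => u t x j) γ volume) =
      fun t => (∫⁻ x, ‖u t x j‖ₑ ^ γ.toReal) ^ (1 / γ.toReal) :=
    funext fun t => eLpNorm_eq_lintegral_rpow_enorm_toReal hγ0 hγtop
  rw [heq]
  exact hGI.pow_const _

/-- In `Fin 3`, `k + 1 ≠ k`. [folklore] -/
private theorem fin3_add_one_ne_bc (k : Fin 3) : k + 1 ≠ k := by
  fin_cases k <;> decide

/-- In `Fin 3`, `k + 2 ≠ k`. [folklore] -/
private theorem fin3_add_two_ne_bc (k : Fin 3) : k + 2 ≠ k := by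
  fin_cases k <;> decide

set_option maxHeartbeats 1600000 in
/-- **A priori bound from two velocity components in the Prodi–Serrin class** (Bae–Choe 2007;
Beirão da Veiga 2017, (1.4), (2.14): the weighted enstrophy inequality integrated with Grönwall).
For a classical unforced solution on `ℝ³ × [0, T)` in the Beale–Kato–Majda class on every
`[0, T'']`, `T'' < T`, with `u_j ∈ L^α(0,T; L^γ)` for the two indices `j ≠ k`,
`2/α + 3/γ = 1`, `3 < γ < ∞`: the `H¹`-type quantity `∫|u(t)|² + ∫|∇u(t)|²_F` is bounded
uniformly in `t ∈ [0, T)`. Ingredients: Tao's energy bound, the slab Grönwall inequality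
`integral_sq_norm_curl_le_mul_exp_of_weight_slab_ae` fed with
`exists_two_mul_integral_stretching_le_of_two_velocity_components` at a.e. time, and
`∫|∇u|² ≤ ∫|ω|²`. [cite: BeiraodaVeiga2017JMAA, §1 (1.4)–(1.11), §2 (2.14) (pp. 3–6); BaeChoe2007CPDE, Thm. 1; Tao2011, Lemma 8.1] -/
theorem exists_uniform_H1_bound_of_two_velocity_components {ν T : ℝ} (hν : 0 < ν) (hT : 0 < T)
    {u : ℝ → (EuclideanSpace ℝ (Fin 3)) → (EuclideanSpace ℝ (Fin 3))}
    {p : ℝ → (EuclideanSpace ℝ (Fin 3)) → ℝ}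
    (hsol : IsClassicalNSSolutionOn (Ico 0 T) ν 0 u p)
    (hreg : ∀ T'' < T, HasBoundedSobolevNormsOn (Icc 0 T'') u)
    {α γ : ℝ≥0∞} (hγ : 3 < γ) (hγtop : γ < ⊤) (hαγ : 2 / α + 3 / γ = 1) (k : Fin 3)
    (hU : ∀ j, j ≠ k → MemLqLp α γ (fun t x => u t x j) (Ioo 0 T)) :
    ∃ A : ℝ, 0 ≤ A ∧ ∀ t ∈ Ico 0 T,
      (∫⁻ x, ‖u t x‖ₑ ^ 2) + (∫⁻ x, ENNReal.ofReal (frobeniusNormSq (fderiv ℝ (u t) x))) ≤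
        ENNReal.ofReal A := by
  obtain ⟨Ce, hCetop, hTao⟩ := tao_finite_energy_smooth_energy_bound_holds
  -- exponents and the stretching constant
  have hγtop' : γ ≠ ⊤ := hγtop.ne
  obtain ⟨hα0, hαtop, hαq⟩ := bc_exponents hγ hγtop' hαγ
  set q : ℝ := 2 * γ.toReal / (γ.toReal - 3) with hq
  have hq0 : 0 ≤ q := by rw [← hαq]; exact ENNReal.toReal_nonneg
  obtain ⟨C, hC0, hstrC⟩ := exists_two_mul_integral_stretching_le_of_two_velocity_components hγ hγtop' hν k
  -- the time weights of the two controlled components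
  set N : Fin 3 → ℝ → ℝ := fun j t => (eLpNorm (fun x => u t x j) γ volume).toReal with hN
  have hN0 : ∀ j t, 0 ≤ N j t := fun j t => ENNReal.toReal_nonneg
  obtain ⟨hI1, hae1⟩ := lintegral_ofReal_toReal_rpow_lt_top_bc hα0 hαtop (hU (k + 1) (fin3_add_one_ne_bc k))
  obtain ⟨hI2, hae2⟩ := lintegral_ofReal_toReal_rpow_lt_top_bc hα0 hαtop (hU (k + 2) (fin3_add_two_ne_bc k))
  rw [hαq] at hI1 hI2
  set I₁ : ℝ≥0∞ := ∫⁻ t in Ioo 0 T, ENNReal.ofReal (N (k + 1) t ^ q) with hI₁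
  set I₂ : ℝ≥0∞ := ∫⁻ t in Ioo 0 T, ENNReal.ofReal (N (k + 2) t ^ q) with hI₂
  have hI₁top : I₁ < ⊤ := hI1
  have hI₂top : I₂ < ⊤ := hI2
  set a : ℝ → ℝ := fun t => C * (N (k + 1) t ^ q + N (k + 2) t ^ q) with ha
  have ha0 : ∀ t, 0 ≤ a t := fun t => by positivity
  set Aw : ℝ := C * (I₁ + I₂).toReal with hAw
  have hAw0 : 0 ≤ Aw := by positivity
  have haE : ∀ t, ENNReal.ofReal (a t) =
      ENNReal.ofReal C * (ENNReal.ofReal (N (k + 1) t ^ q) + ENNReal.ofReal (N (k + 2) t ^ q)) := by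
    intro t
    rw [ha]; dsimp only
    rw [ENNReal.ofReal_mul hC0, ENNReal.ofReal_add (by positivity) (by positivity)]
  -- measurability in time of the weights
  have hγ0 : γ ≠ 0 := (lt_trans (by norm_num) hγ).ne'
  have hNmeas : ∀ j, AEMeasurable (fun t => ENNReal.ofReal (N j t ^ q)) (volume.restrict (Ioo 0 T)) := by
    intro j
    have hE := aemeasurable_eLpNorm_apply_bc hsol hγ0 hγtop' j
    have hNj : AEMeasurable (N j) (volume.restrict (Ioo 0 T)) :=
      ENNReal.measurable_toReal.comp_aemeasurable hE
    exact ENNReal.measurable_ofReal.comp_aemeasurable (hNj.pow_const q)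
  have hAint : ∀ T'' ≤ T, ∫⁻ t in Ioo 0 T'', ENNReal.ofReal (a t) ≤ ENNReal.ofReal Aw := by
    intro T'' hT''
    have hCtop : ENNReal.ofReal C ≠ ⊤ := ENNReal.ofReal_ne_top
    calc ∫⁻ t in Ioo 0 T'', ENNReal.ofReal (a t)
        ≤ ∫⁻ t in Ioo 0 T, ENNReal.ofReal (a t) := lintegral_mono_set (Ioo_subset_Ioo le_rfl hT'')
      _ = ∫⁻ t in Ioo 0 T, ENNReal.ofReal C *
            (ENNReal.ofReal (N (k + 1) t ^ q) + ENNReal.ofReal (N (k + 2) t ^ q)) :=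
          lintegral_congr fun t => haE t
      _ = ENNReal.ofReal C * (I₁ + I₂) := by
          rw [lintegral_const_mul' _ _ hCtop, lintegral_add_left' (hNmeas (k + 1))]
      _ = ENNReal.ofReal Aw := by
          rw [hAw, ENNReal.ofReal_mul hC0, ENNReal.ofReal_toReal]
          exact (ENNReal.add_lt_top.2 ⟨hI₁top, hI₂top⟩).ne
  -- a.e. finiteness of the two vorticity components in `L^γ`
  have hae1' : ∀ᵐ s ∂volume, s ∈ Ioo 0 T → eLpNorm (fun x => u s x (k + 1)) γ volume < ⊤ := hae1
  have hae2' : ∀ᵐ s ∂volume, s ∈ Ioo 0 T → eLpNorm (fun x => u s x (k + 2)) γ volume < ⊤ := hae2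
  -- the initial energy and enstrophy
  have hreg0 : HasBoundedSobolevNormsOn (Icc 0 (T / 2)) u := hreg (T / 2) (by linarith)
  have h00 : (0 : ℝ) ∈ Icc 0 (T / 2) := ⟨le_rfl, by linarith⟩
  set E₀ : ℝ≥0∞ := ∫⁻ x, ‖u 0 x‖ₑ ^ 2 with hE₀
  have hE₀top : E₀ < ⊤ := by
    obtain ⟨C0, hC0'⟩ := hreg0 0
    refine lt_of_le_of_lt (le_of_eq (lintegral_congr fun x => ?_)) ((hC0' 0 h00).trans_lt ENNReal.coe_lt_top)
    rw [← ofReal_norm, ← ofReal_norm, norm_iteratedFDeriv_zero]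
  have hCE : Ce * E₀ < ⊤ := ENNReal.mul_lt_top hCetop hE₀top
  set Ē : ℝ := (Ce * E₀).toReal with hĒ
  have hĒ0 : 0 ≤ Ē := ENNReal.toReal_nonneg
  set Y₀ : ℝ := ∫ x, ‖curl (u 0) x‖ ^ 2 with hY₀
  have hY₀0 : 0 ≤ Y₀ := integral_nonneg fun x => sq_nonneg _
  set Ystar : ℝ := Y₀ * Real.exp Aw with hYstar
  have hYstar0 : 0 ≤ Ystar := by positivity
  refine ⟨Ē + Ystar, by positivity, ?_⟩
  intro t ht
  -- a closed slab containing `t`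
  set T'' : ℝ := (t + T) / 2 with hT''def
  have htT'' : t < T'' := by rw [hT''def]; linarith [ht.2]
  have hT''T : T'' < T := by rw [hT''def]; linarith [ht.2]
  have hT''pos : 0 < T'' := lt_of_le_of_lt ht.1 htT''
  have hS : IsClassicalNSSolutionOn (Icc 0 T'') ν 0 u p :=
    hsol.mono (Icc_subset_Ico_right hT''T) (uniqueDiffOn_Icc hT''pos)
  have hB : HasBoundedSobolevNormsOn (Icc 0 T'') u := hreg T'' hT''T
  have htS : t ∈ Icc 0 T'' := ⟨ht.1, htT''.le⟩
  have hsm : ∀ s ∈ Icc 0 T'', ContDiff ℝ ∞ (u s) := fun s hs => hS.contDiff_velocity hs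
  have hsm3 : ∀ s ∈ Icc 0 T'', ContDiff ℝ 3 (u s) := fun s hs => (hsm s hs).of_le (by norm_cast)
  have hsm2 : ∀ s ∈ Icc 0 T'', ContDiff ℝ 2 (u s) := fun s hs => (hsm s hs).of_le (by norm_cast)
  have hfin : ∀ n, ∀ s ∈ Icc 0 T'', ∫⁻ x, ‖iteratedFDeriv ℝ n (u s) x‖ₑ ^ 2 < ⊤ := fun n s hs => by
    obtain ⟨Cn, hCn⟩ := hB n
    exact (hCn s hs).trans_lt ENNReal.coe_lt_top
  obtain ⟨B₀, hB₀⟩ := linfty_bound_of_hasBoundedSobolevNormsOn_holds hsm2 hB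
  obtain ⟨B₁, hB₁0, hB₁⟩ := exists_forall_norm_fderiv_le_of_hasBoundedSobolevNormsOn hsm3 hB
  -- Tao's energy class on the slab
  have hfe : ∃ A : ℝ≥0∞, A < ⊤ ∧ ∀ s ∈ Icc 0 T'', ∫⁻ x, ‖u s x‖ₑ ^ 2 ≤ A := by
    obtain ⟨C0, hC0'⟩ := hB 0
    refine ⟨C0, ENNReal.coe_lt_top, fun s hs => ?_⟩
    refine le_trans (le_of_eq (lintegral_congr fun x => ?_)) (hC0' s hs)
    rw [← ofReal_norm, ← ofReal_norm, norm_iteratedFDeriv_zero]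
  obtain ⟨hen, -⟩ := hTao ν T'' hν hT''pos u p hS hfe
  have hen' : ∀ s ∈ Icc 0 T'', ∫⁻ x, ‖u s x‖ₑ ^ 2 ≤ ENNReal.ofReal Ē := fun s hs => by
    rw [hĒ, ENNReal.ofReal_toReal hCE.ne]
    exact hen s hs
  -- the slices on the slab: `L²`, `L^∞` tails
  have hL2 : ∀ s ∈ Icc 0 T'', eLpNorm (u s) 2 volume < ⊤ := fun s hs => by
    refine eLpNorm_two_lt_top_of_lintegral_enorm_sq_lt_top ?_
    exact (hen' s hs).trans_lt ENNReal.ofReal_lt_top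
  have hLinf : ∀ s ∈ Icc 0 T'', eLpNorm (u s) ⊤ volume < ⊤ := fun s hs => by
    rw [eLpNorm_exponent_top]
    refine lt_of_le_of_lt (eLpNormEssSup_le_of_ae_enorm_bound (C := ENNReal.ofReal B₀)
      (Eventually.of_forall fun x => ?_)) ENNReal.ofReal_lt_top
    rw [← ofReal_norm]
    exact ENNReal.ofReal_le_ofReal (hB₀ s hs x)
  -- the stretching estimate at a.e. time of the slab
  have hstrS : ∀ᵐ s ∂(volume.restrict (Ioo 0 T'')),
      2 * ∫ x, ⟪curl (u s) x, fderiv ℝ (u s) x (curl (u s) x)⟫ ≤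
        ν * (∫ x, frobeniusNormSq (fderiv ℝ (curl (u s)) x)) + a s * (∫ x, ‖curl (u s) x‖ ^ 2) := by
    rw [ae_restrict_iff' measurableSet_Ioo]
    filter_upwards [hae1', hae2'] with s h1 h2 hsI
    have hsT : s ∈ Ioo 0 T := ⟨hsI.1, hsI.2.trans hT''T⟩
    have hsS : s ∈ Icc 0 T'' := ⟨hsI.1.le, hsI.2.le⟩
    exact hstrC (u s) (hsm s hsS) (hS.divFree s hsS) (hL2 s hsS) (hLinf s hsS) (hB₀ s hsS) (hB₁ s hsS)
      (hfin 1 s hsS) (hfin 2 s hsS) (h1 hsT) (h2 hsT)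
  -- the enstrophy bound on the slab
  have hY := integral_sq_norm_curl_le_mul_exp_of_weight_slab_ae hν hT''pos hS hB ha0 hAw0
    (hAint T'' hT''T.le) hstrS t htS
  have hYstar_le : ∫ x, ‖curl (u t) x‖ ^ 2 ≤ Ystar := hY
  -- the `H¹` quantity
  have hvt : ContDiff ℝ ∞ (u t) := hS.contDiff_velocity htS
  have hcurl_int : Integrable fun x => ‖curl (u t) x‖ ^ 2 := by
    refine integrable_sq_norm_of_lintegral_lt_top (continuous_curl (hvt.of_le (by norm_cast))) ?_
    exact lt_of_le_of_lt (lintegral_curl_sq_le (u t)) (ENNReal.mul_lt_top ENNReal.ofReal_lt_top (hfin 1 t htS))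
  have hdc : ∫⁻ x, ENNReal.ofReal (frobeniusNormSq (fderiv ℝ (u t) x)) ≤ ENNReal.ofReal Ystar := by
    refine (lintegral_frobeniusNormSq_fderiv_le_lintegral_sq_norm_curl
      (hvt.of_le (by norm_cast)) (hS.divFree t htS)
      ((hen' t htS).trans_lt ENNReal.ofReal_lt_top)).trans ?_
    rw [show (∫⁻ x, ‖curl (u t) x‖ₑ ^ 2) = ∫⁻ x, ENNReal.ofReal (‖curl (u t) x‖ ^ 2) from
      lintegral_congr fun x => by rw [← ofReal_norm, ENNReal.ofReal_pow (norm_nonneg _)],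
      ← ofReal_integral_eq_lintegral_ofReal hcurl_int (Eventually.of_forall fun x => sq_nonneg _)]
    exact ENNReal.ofReal_le_ofReal hYstar_le
  calc (∫⁻ x, ‖u t x‖ₑ ^ 2) + (∫⁻ x, ENNReal.ofReal (frobeniusNormSq (fderiv ℝ (u t) x)))
      ≤ ENNReal.ofReal Ē + ENNReal.ofReal Ystar := add_le_add (hen' t htS) hdc
    _ = ENNReal.ofReal (Ē + Ystar) := (ENNReal.ofReal_add hĒ0 hYstar0).symm

/-- **The Bae–Choe criterion: two velocity components in the Prodi–Serrin class give
continuation** (Bae–Choe 2007, as restated by Beirão da Veiga 2017, §1: "in this way the authors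
proved that (1.4) holds if merely `ū` (instead of `u`) satisfies the Prodi–Serrin condition"
`ū ∈ L^q(0,T; L^p)`, `2/q + 3/p ≤ 1`, `p > 3`; "`ū` may be any 2-dimensional component of the
velocity"). Rendering (that of the tree's `chaeChoe_two_vorticity_components_criterion`): for a
classical unforced solution on `ℝ³ × [0, T)` in the Beale–Kato–Majda class, if for an index `k`
the two other velocity components `u_j`, `j ≠ k`, lie in `L^α(0,T; L^γ(ℝ³))` with
`2/α + 3/γ = 1`, `3 < γ < ∞`, the solution continues in the class past `T`
(`exists_uniform_H1_bound_of_two_velocity_components` and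
`hasSobolevExtensionPast_of_uniform_H1_bound`). The printed conclusion is the strong class
`L^∞H¹ ∩ L²H²` for weak solutions; the endpoint `γ = ∞` is
`baeChoe_two_velocity_components_criterion_top` below.
[cite: BeiraodaVeiga2017JMAA, §1 (statement after (1.9)) and Thm. 1.1 (pp. 3–4); BaeChoe2007CPDE, Thm. 1] -/
theorem baeChoe_two_velocity_components_criterion {ν : ℝ} (hν : 0 < ν) {T : ℝ} (hT : 0 < T)
    {u : ℝ → (EuclideanSpace ℝ (Fin 3)) → (EuclideanSpace ℝ (Fin 3))}
    {p : ℝ → (EuclideanSpace ℝ (Fin 3)) → ℝ}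
    (hsol : IsClassicalNSSolutionOn (Ico 0 T) ν 0 u p)
    (hreg : ∀ T'' < T, HasBoundedSobolevNormsOn (Icc 0 T'') u)
    {α γ : ℝ≥0∞} (hγ : 3 < γ) (hγtop : γ < ⊤) (hαγ : 2 / α + 3 / γ = 1) (k : Fin 3)
    (hU : ∀ j, j ≠ k → MemLqLp α γ (fun t x => u t x j) (Ioo 0 T)) :
    HasSobolevExtensionPast ν u T := by
  obtain ⟨A, hA0, hA⟩ :=
    exists_uniform_H1_bound_of_two_velocity_components hν hT hsol hreg hγ hγtop hαγ k hU
  exact hasSobolevExtensionPast_of_uniform_H1_bound hν hT hsol hreg hA0 hA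

/-- **The printed hypothesis `2/α + 3/γ ≤ 1`** (the Prodi–Serrin condition (1.3) of
Beirão da Veiga 2017 for `ū`), for `3 < γ < ∞` and any `α ≤ ∞`: on the bounded interval
`(0, T)` the hypothesis reduces to the critical one `2/α' + 3/γ = 1`, `α' = 2γ/(γ−3) ≤ α`, by
Hölder's inequality in time (`MemLqLp.of_exponent_le`). [cite: BeiraodaVeiga2017JMAA, §1 (1.3) and the statement after (1.9) (p. 3); BaeChoe2007CPDE, Thm. 1] -/
theorem baeChoe_two_velocity_components_criterion_of_le {ν : ℝ} (hν : 0 < ν) {T : ℝ}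
    (hT : 0 < T)
    {u : ℝ → (EuclideanSpace ℝ (Fin 3)) → (EuclideanSpace ℝ (Fin 3))}
    {p : ℝ → (EuclideanSpace ℝ (Fin 3)) → ℝ}
    (hsol : IsClassicalNSSolutionOn (Ico 0 T) ν 0 u p)
    (hreg : ∀ T'' < T, HasBoundedSobolevNormsOn (Icc 0 T'') u)
    {α γ : ℝ≥0∞} (hγ : 3 < γ) (hγtop : γ < ⊤) (hαγ : 2 / α + 3 / γ ≤ 1) (k : Fin 3)
    (hU : ∀ j, j ≠ k → MemLqLp α γ (fun t x => u t x j) (Ioo 0 T)) :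
    HasSobolevExtensionPast ν u T := by
  -- the real exponent data
  have hγ0 : γ ≠ 0 := (lt_trans (by norm_num) hγ).ne'
  have hγtop' : γ ≠ ⊤ := hγtop.ne
  set ρ : ℝ := γ.toReal with hρ
  have hρ3 : 3 < ρ := toReal_three_lt_bc hγ hγtop'
  have hρ0 : 0 < ρ := by linarith
  have hρ3' : 0 < ρ - 3 := by linarith
  have hγρ : γ = ENNReal.ofReal ρ := (ENNReal.ofReal_toReal hγtop').symm
  -- the critical time exponent `α' = 2ρ/(ρ-3)`, `2/α' + 3/γ = 1`
  set a' : ℝ := 2 * ρ / (ρ - 3) with ha'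
  have ha'0 : 0 < a' := by rw [ha']; positivity
  set α' : ℝ≥0∞ := ENNReal.ofReal a' with hα'
  have hα'γ : 2 / α' + 3 / γ = 1 := by
    rw [hα', hγρ, show (2 : ℝ≥0∞) = ENNReal.ofReal 2 by norm_num,
      show (3 : ℝ≥0∞) = ENNReal.ofReal 3 by norm_num,
      ← ENNReal.ofReal_div_of_pos ha'0, ← ENNReal.ofReal_div_of_pos hρ0,
      ← ENNReal.ofReal_add (by positivity) (by positivity), ← ENNReal.ofReal_one]
    congr 1
    rw [ha']; field_simp; ring
  -- `α' ≤ α`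
  have hα'α : α' ≤ α := by
    by_cases hαtop : α = ⊤
    · rw [hαtop]; exact le_top
    · have hα0 : α ≠ 0 := by
        rintro rfl
        rw [ENNReal.div_zero (by norm_num : (2 : ℝ≥0∞) ≠ 0), top_add] at hαγ
        exact absurd hαγ (not_le.2 ENNReal.one_lt_top)
      have ha0 : 0 < α.toReal := ENNReal.toReal_pos hα0 hαtop
      have h2 : 2 / α.toReal + 3 / ρ ≤ 1 := by
        have hfin1 : 2 / α ≠ ⊤ := ENNReal.div_ne_top (by norm_num) hα0
        have hfin2 : 3 / γ ≠ ⊤ := ENNReal.div_ne_top (by norm_num) hγ0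
        have h := (ENNReal.toReal_le_toReal (ENNReal.add_ne_top.2 ⟨hfin1, hfin2⟩) ENNReal.one_ne_top).2 hαγ
        rw [ENNReal.toReal_add hfin1 hfin2, ENNReal.toReal_div, ENNReal.toReal_div,
          ENNReal.toReal_ofNat, ENNReal.toReal_ofNat, ENNReal.toReal_one] at h
        exact h
      have h2' : 2 / α.toReal ≤ 1 - 3 / ρ := by linarith
      have h2'' : 2 ≤ (1 - 3 / ρ) * α.toReal := (div_le_iff₀ ha0).1 h2'
      have h3 : a' ≤ α.toReal := by
        rw [ha', div_le_iff₀ hρ3']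
        have e : (1 - 3 / ρ) * α.toReal * ρ = α.toReal * (ρ - 3) := by field_simp
        nlinarith [h2'', e, hρ0]
      calc α' = ENNReal.ofReal a' := rfl
        _ ≤ ENNReal.ofReal α.toReal := ENNReal.ofReal_le_ofReal h3
        _ = α := ENNReal.ofReal_toReal hαtop
  -- Hölder in time
  have hU' : ∀ j, j ≠ k → MemLqLp α' γ (fun t x => u t x j) (Ioo 0 T) := by
    intro j hj
    refine (hU j hj).of_exponent_le hα'α measure_Ioo_lt_top.ne ?_
    exact (ENNReal.measurable_toReal.comp_aemeasurable
      (aemeasurable_eLpNorm_apply_bc hsol hγ0 hγtop' j)).aestronglyMeasurable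
  exact baeChoe_two_velocity_components_criterion hν hT hsol hreg hγ hγtop hα'γ k hU'


end Criterion

section Endpoint

/-! ### The endpoint `γ = ∞`: two velocity components in `L²(0,T; L^∞)` -/

variable {v : EuclideanSpace ℝ (Fin 3) → EuclideanSpace ℝ (Fin 3)}

/-- A continuous function on `ℝ³` is bounded pointwise by its `L^∞` norm (Lebesgue measure charges
open sets). [folklore] -/
private theorem enorm_le_eLpNorm_top_of_continuous_bc {F : Type*} [NormedAddCommGroup F]
    {f : EuclideanSpace ℝ (Fin 3) → F} (hf : Continuous f) (x : EuclideanSpace ℝ (Fin 3)) :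
    ‖f x‖ₑ ≤ eLpNorm f ⊤ volume := by
  rw [eLpNorm_exponent_top]
  by_contra h
  rw [not_le] at h
  have hU : IsOpen {y | eLpNormEssSup f volume < ‖f y‖ₑ} := isOpen_lt continuous_const hf.enorm
  have hnull : volume {y | eLpNormEssSup f volume < ‖f y‖ₑ} = 0 := by
    have hae : ∀ᵐ y ∂(volume : Measure (EuclideanSpace ℝ (Fin 3))), ‖f y‖ₑ ≤ eLpNormEssSup f volume :=
      ae_le_eLpNormEssSup
    rw [ae_iff] at hae
    simpa only [not_le] using hae
  have hem := (hU.measure_eq_zero_iff (μ := volume)).1 hnull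
  have hx : x ∈ {y | eLpNormEssSup f volume < ‖f y‖ₑ} := h
  rw [hem] at hx
  exact hx

/-- For a continuous function on `ℝ³` and a dense set `D`, the `L^∞` norm is the supremum over
`D`. [folklore] -/
private theorem eLpNorm_top_eq_iSup_of_continuous_bc {F : Type*} [NormedAddCommGroup F]
    {f : EuclideanSpace ℝ (Fin 3) → F} (hf : Continuous f) {D : Set (EuclideanSpace ℝ (Fin 3))}
    (hD : Dense D) : eLpNorm f ⊤ volume = ⨆ q : D, ‖f q‖ₑ := by
  refine le_antisymm ?_ (iSup_le fun q => enorm_le_eLpNorm_top_of_continuous_bc hf q)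
  rw [eLpNorm_exponent_top]
  refine essSup_le_of_ae_le _ (Eventually.of_forall fun y => ?_)
  have hC : IsClosed {z | ‖f z‖ₑ ≤ ⨆ q : D, ‖f q‖ₑ} := isClosed_le hf.enorm continuous_const
  have hDC : D ⊆ {z | ‖f z‖ₑ ≤ ⨆ q : D, ‖f q‖ₑ} := fun z hz => le_iSup (fun q : D => ‖f q‖ₑ) ⟨z, hz⟩
  have hy : y ∈ closure D := by rw [hD.closure_eq]; exact mem_univ _
  exact closure_minimal hDC hC hy

/-- Young's inequality for the three products of the endpoint estimate, in polynomial form: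
`2n(6dw + gd + hw) ≤ (2ν/3)d² + (ν/27)h² + (n²/ν)(135w² + 3g²)` for `ν > 0`
(`ν·(RHS − LHS) = (νd − 18nw)²/3 + (νd − 3ng)²/3 + (νh − 27nw)²/27`). [folklore] -/
private theorem young_three_bc {ν n w d g h : ℝ} (hν : 0 < ν) :
    2 * (n * (6 * (d * w) + g * d + h * w)) ≤
      (2 * ν / 3) * d ^ 2 + (ν / 27) * h ^ 2 + n ^ 2 / ν * (135 * w ^ 2 + 3 * g ^ 2) := by
  have key : 2 * (n * (6 * (d * w) + g * d + h * w)) * ν ≤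
      ((2 * ν / 3) * d ^ 2 + (ν / 27) * h ^ 2) * ν + n ^ 2 * (135 * w ^ 2 + 3 * g ^ 2) := by
    nlinarith [sq_nonneg (ν * d - 18 * n * w), sq_nonneg (ν * d - 3 * n * g),
      sq_nonneg (ν * h - 27 * n * w)]
  have h1 : 2 * (n * (6 * (d * w) + g * d + h * w)) ≤
      (((2 * ν / 3) * d ^ 2 + (ν / 27) * h ^ 2) * ν + n ^ 2 * (135 * w ^ 2 + 3 * g ^ 2)) / ν := by
    rw [le_div_iff₀ hν]; exact key
  refine h1.trans (le_of_eq ?_)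
  field_simp

set_option maxHeartbeats 1600000 in
/-- **The Bae–Choe estimate at the endpoint `γ = ∞`** (`q = 2`: the case `p = ∞` of the
Prodi–Serrin condition `2/q + 3/p ≤ 1` for `ū`; Beirão da Veiga 2017, (1.9)–(1.11) with
`‖|ū| ∇u‖₂ ≤ ‖ū‖_∞ ‖∇u‖₂`). For a `C^∞` divergence-free field `v` on `ℝ³`, bounded with bounded
gradient, `v ∈ L²`, `∇v, ∇²v ∈ L²`, `ω = curl v`, `ν > 0` and an index `k`:
`2∫⟪ω, (∇v)ω⟫ ≤ ν ∫|∇ω|²_F + (138/ν)(‖v_{k+1}‖_∞ + ‖v_{k+2}‖_∞)² ∫|ω|²`: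
`integral_inner_curl_stretching_le_two_components`, `|v_j(x)| ≤ ‖v_j‖_∞`, Young's inequality on
the three products, `‖∇v‖₂ ≤ ‖ω‖₂` and `‖∇²v_k‖₂ ≤ 3‖∇ω‖₂` (`div v = 0`). The constant is not a
printed one. [cite: BeiraodaVeiga2017JMAA, §1 (1.3), (1.8)–(1.11) and §2 (2.11)–(2.14) (pp. 3–6); BaeChoe2007CPDE, Thm. 1] -/
theorem two_mul_integral_stretching_le_of_two_velocity_components_top (k : Fin 3) {ν : ℝ}
    (hν : 0 < ν) (v : EuclideanSpace ℝ (Fin 3) → EuclideanSpace ℝ (Fin 3)) (hv : ContDiff ℝ ∞ v)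
    (hdiv : VectorCalculus.IsDivFree v) (hL2 : ∫⁻ x, ‖v x‖ₑ ^ 2 < ⊤)
    {B : ℝ} (hB : ∀ x, ‖v x‖ ≤ B) {B₁ : ℝ} (hB₁ : ∀ x, ‖fderiv ℝ v x‖ ≤ B₁)
    (hv1 : ∫⁻ x, ‖iteratedFDeriv ℝ 1 v x‖ₑ ^ 2 < ⊤) (hv2 : ∫⁻ x, ‖iteratedFDeriv ℝ 2 v x‖ₑ ^ 2 < ⊤) :
    2 * ∫ x, ⟪curl v x, fderiv ℝ v x (curl v x)⟫ ≤
      ν * (∫ x, frobeniusNormSq (fderiv ℝ (curl v) x)) +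
        138 / ν * ((eLpNorm (fun x => v x (k + 1)) ⊤ volume).toReal +
            (eLpNorm (fun x => v x (k + 2)) ⊤ volume).toReal) ^ 2 * ∫ x, ‖curl v x‖ ^ 2 := by
  -- the fields and their regularity
  have hv3 : ContDiff ℝ 3 v := hv.of_le (by norm_cast)
  have hv2c : ContDiff ℝ 2 v := hv.of_le (by norm_cast)
  set om : EuclideanSpace ℝ (Fin 3) → EuclideanSpace ℝ (Fin 3) := curl v with homdef
  have hom : ContDiff ℝ ∞ om := contDiff_curl (n := ⊤) (hv.of_le (by exact_mod_cast le_top))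
  have hom1 : ContDiff ℝ 1 om := hom.of_le (by norm_cast)
  have cω : Continuous om := hom.continuous
  have cDv : Continuous (fderiv ℝ v) := hv.continuous_fderiv (by simp)
  have cDω : Continuous (fderiv ℝ om) := hom.continuous_fderiv (by simp)
  set vc : Fin 3 → EuclideanSpace ℝ (Fin 3) → ℝ := fun j y => v y j with hvc
  have cvc : ∀ j, Continuous (vc j) := fun j => (contDiff_apply_bc hv j).continuous
  have cDDk : Continuous (fderiv ℝ (fderiv ℝ (vc k))) :=
    (((contDiff_apply_bc hv2c k)).fderiv_right (m := 1) (by norm_num)).continuous_fderiv one_ne_zero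
  -- `L²` finiteness of `ω, ∇ω, ∇v, ∇²v_k`
  have l2ω : ∫⁻ x, ‖om x‖ₑ ^ 2 < ⊤ :=
    lt_of_le_of_lt (lintegral_curl_sq_le v) (ENNReal.mul_lt_top ENNReal.ofReal_lt_top hv1)
  have l2Dω : ∫⁻ x, ‖fderiv ℝ om x‖ₑ ^ 2 < ⊤ := by
    have hle : ∀ x, ‖fderiv ℝ om x‖ ≤ ‖(‖curlCLM‖) • iteratedFDeriv ℝ 2 v x‖ := fun x => by
      rw [norm_smul, Real.norm_of_nonneg (norm_nonneg _), homdef]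
      exact norm_fderiv_curl_le hv2c x
    exact lintegral_enorm_sq_lt_top_of_norm_le hle (lintegral_enorm_sq_const_smul_lt_top _ hv2)
  have l2Dv : ∫⁻ x, ‖fderiv ℝ v x‖ₑ ^ 2 < ⊤ := by
    refine lt_of_le_of_lt (le_of_eq (lintegral_congr fun x => ?_)) hv1
    rw [← ofReal_norm, ← ofReal_norm, norm_iteratedFDeriv_one v]
  have l2DDk : ∫⁻ x, ‖fderiv ℝ (fderiv ℝ (vc k)) x‖ₑ ^ 2 < ⊤ := by
    have hle : ∀ x, ‖fderiv ℝ (fderiv ℝ (vc k)) x‖ ≤ ‖(1 : ℝ) • iteratedFDeriv ℝ 2 v x‖ := fun x => by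
      rw [one_smul]
      refine (norm_fderiv_fderiv_apply_le_bc hv2c x k).trans (le_of_eq ?_)
      rw [← norm_iteratedFDeriv_fderiv, norm_iteratedFDeriv_one]
    exact lintegral_enorm_sq_lt_top_of_norm_le hle (lintegral_enorm_sq_const_smul_lt_top _ hv2)
  have i_a : Integrable (fun x => ‖om x‖ ^ 2) volume := integrable_sq_norm_of_lintegral_lt_top cω l2ω
  have iDω2 : Integrable (fun x => ‖fderiv ℝ om x‖ ^ 2) volume :=
    integrable_sq_norm_of_lintegral_lt_top cDω l2Dω
  have iDv2 : Integrable (fun x => ‖fderiv ℝ v x‖ ^ 2) volume :=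
    integrable_sq_norm_of_lintegral_lt_top cDv l2Dv
  have iDDk2 : Integrable (fun x => ‖fderiv ℝ (fderiv ℝ (vc k)) x‖ ^ 2) volume :=
    integrable_sq_norm_of_lintegral_lt_top cDDk l2DDk
  -- the dissipation `R = ∫|∇ω|²_F`
  have hRlt : ∫⁻ x, ENNReal.ofReal (frobeniusNormSq (fderiv ℝ om x)) < ⊤ := by
    calc ∫⁻ x, ENNReal.ofReal (frobeniusNormSq (fderiv ℝ om x))
        ≤ ∫⁻ x, 3 * ‖fderiv ℝ om x‖ₑ ^ 2 :=
          lintegral_mono fun x => ofReal_frobeniusNormSq_le_three_mul_enorm_sq _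
      _ = 3 * ∫⁻ x, ‖fderiv ℝ om x‖ₑ ^ 2 := lintegral_const_mul' _ _ (by norm_num)
      _ < ⊤ := ENNReal.mul_lt_top (by norm_num) l2Dω
  have i_R : Integrable (fun x => frobeniusNormSq (fderiv ℝ om x)) volume :=
    integrable_of_continuous_of_nonneg (continuous_frobeniusNormSq_fderiv hom1 (by simp))
      (fun x => frobeniusNormSq_nonneg _) hRlt
  set a : ℝ := ∫ x, ‖om x‖ ^ 2 with ha
  set R : ℝ := ∫ x, frobeniusNormSq (fderiv ℝ om x) with hR
  set Dop : ℝ := ∫ x, ‖fderiv ℝ om x‖ ^ 2 with hDop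
  set G : ℝ := ∫ x, ‖fderiv ℝ v x‖ ^ 2 with hG
  set H : ℝ := ∫ x, ‖fderiv ℝ (fderiv ℝ (vc k)) x‖ ^ 2 with hH
  have ha0 : 0 ≤ a := integral_nonneg fun x => sq_nonneg _
  have hR0 : 0 ≤ R := integral_nonneg fun x => frobeniusNormSq_nonneg _
  have hDop0 : 0 ≤ Dop := integral_nonneg fun x => sq_nonneg _
  have hH0 : 0 ≤ H := integral_nonneg fun x => sq_nonneg _
  -- `∫‖∇ω‖² ≤ ∫|∇ω|²_F`
  have hDopR : Dop ≤ R := integral_mono iDω2 i_R fun x => sq_opNorm_le_frobeniusNormSq _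
  -- `∫‖∇v‖² ≤ ∫|ω|²` (`div v = 0`)
  have hGa : G ≤ a := by
    have h1 : ENNReal.ofReal G ≤ ENNReal.ofReal a := by
      rw [hG, ha, ofReal_integral_eq_lintegral_ofReal iDv2 (Eventually.of_forall fun x => sq_nonneg _),
        ofReal_integral_eq_lintegral_ofReal i_a (Eventually.of_forall fun x => sq_nonneg _)]
      calc ∫⁻ x, ENNReal.ofReal (‖fderiv ℝ v x‖ ^ 2)
          ≤ ∫⁻ x, ENNReal.ofReal (frobeniusNormSq (fderiv ℝ v x)) :=
            lintegral_mono fun x => ENNReal.ofReal_le_ofReal (sq_opNorm_le_frobeniusNormSq _)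
        _ ≤ ∫⁻ x, ‖om x‖ₑ ^ 2 :=
            lintegral_frobeniusNormSq_fderiv_le_lintegral_sq_norm_curl hv2c hdiv hL2
        _ = ∫⁻ x, ENNReal.ofReal (‖om x‖ ^ 2) :=
            lintegral_congr fun x => by rw [← ofReal_norm, ENNReal.ofReal_pow (norm_nonneg _)]
    exact (ENNReal.ofReal_le_ofReal_iff ha0).1 h1
  -- `∫‖∇²v_k‖² ≤ 9 ∫‖∇ω‖²` (`div v = 0`)
  have hHD : H ≤ 9 * Dop := by
    have h9 := lintegral_fderiv_fderiv_sq_le_bc hv3 hdiv hv1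
    rw [← homdef] at h9
    have h1 : ENNReal.ofReal H ≤ ENNReal.ofReal (9 * Dop) := by
      rw [hH, hDop, ofReal_integral_eq_lintegral_ofReal iDDk2 (Eventually.of_forall fun x => sq_nonneg _),
        ENNReal.ofReal_mul (by norm_num), ENNReal.ofReal_ofNat,
        ofReal_integral_eq_lintegral_ofReal iDω2 (Eventually.of_forall fun x => sq_nonneg _)]
      calc ∫⁻ x, ENNReal.ofReal (‖fderiv ℝ (fderiv ℝ (vc k)) x‖ ^ 2)
          ≤ ∫⁻ x, ‖fderiv ℝ (fderiv ℝ v) x‖ₑ ^ 2 := by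
            refine lintegral_mono fun x => ?_
            rw [ENNReal.ofReal_pow (norm_nonneg _), ofReal_norm]
            gcongr
            rw [← ofReal_norm, ← ofReal_norm]
            exact ENNReal.ofReal_le_ofReal (norm_fderiv_fderiv_apply_le_bc hv2c x k)
        _ ≤ 9 * ∫⁻ x, ‖fderiv ℝ om x‖ₑ ^ 2 := h9
        _ = 9 * ∫⁻ x, ENNReal.ofReal (‖fderiv ℝ om x‖ ^ 2) := by
            congr 1
            exact lintegral_congr fun x => by rw [← ofReal_norm, ENNReal.ofReal_pow (norm_nonneg _)]
    exact (ENNReal.ofReal_le_ofReal_iff (by positivity)).1 h1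
  -- the sup norms of the two components
  have hvctop : ∀ j, eLpNorm (vc j) ⊤ volume < ⊤ := fun j => by
    rw [eLpNorm_exponent_top]
    refine lt_of_le_of_lt (eLpNormEssSup_le_of_ae_enorm_bound (C := ENNReal.ofReal B)
      (Eventually.of_forall fun x => ?_)) ENNReal.ofReal_lt_top
    rw [← ofReal_norm, Real.norm_eq_abs]
    exact ENNReal.ofReal_le_ofReal ((abs_apply_le_norm_bc (v x) j).trans (hB x))
  set N : Fin 3 → ℝ := fun j => (eLpNorm (vc j) ⊤ volume).toReal with hN
  have hN0 : ∀ j, 0 ≤ N j := fun j => ENNReal.toReal_nonneg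
  have hvN : ∀ j x, |vc j x| ≤ N j := by
    intro j x
    have h := enorm_le_eLpNorm_top_of_continuous_bc (cvc j) x
    rw [← ofReal_norm, Real.norm_eq_abs] at h
    exact (ENNReal.ofReal_le_iff_le_toReal (hvctop j).ne).1 h
  set Ns : ℝ := N (k + 1) + N (k + 2) with hNs
  have hNs0 : 0 ≤ Ns := add_nonneg (hN0 _) (hN0 _)
  -- Part 1: the structure estimate
  set Φ : EuclideanSpace ℝ (Fin 3) → ℝ := fun x => (|v x (k + 1)| + |v x (k + 2)|) *
    (6 * (‖fderiv ℝ (curl v) x‖ * ‖curl v x‖) + ‖fderiv ℝ v x‖ * ‖fderiv ℝ (curl v) x‖ +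
      ‖fderiv ℝ (fderiv ℝ (fun y => v y k)) x‖ * ‖curl v x‖) with hΦ
  have hΦ0 : ∀ x, 0 ≤ Φ x := fun x => by positivity
  have hS1 : ∫ x, ⟪om x, fderiv ℝ v x (om x)⟫ ≤ ∫ x, Φ x :=
    integral_inner_curl_stretching_le_two_components k hv3 hB hB₁ hv1 hv2
  -- Part 2: the pointwise Young majorant
  set M : EuclideanSpace ℝ (Fin 3) → ℝ := fun x =>
    (2 * ν / 3) * ‖fderiv ℝ om x‖ ^ 2 + (ν / 27) * ‖fderiv ℝ (fderiv ℝ (vc k)) x‖ ^ 2 +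
      Ns ^ 2 / ν * (135 * ‖om x‖ ^ 2 + 3 * ‖fderiv ℝ v x‖ ^ 2) with hM
  have hvk : (fun y => v y k) = vc k := rfl
  have hpt : ∀ x, 2 * Φ x ≤ M x := by
    intro x
    have h1 : |v x (k + 1)| + |v x (k + 2)| ≤ Ns := add_le_add (hvN (k + 1) x) (hvN (k + 2) x)
    have h2 : Φ x ≤ Ns * (6 * (‖fderiv ℝ om x‖ * ‖om x‖) + ‖fderiv ℝ v x‖ * ‖fderiv ℝ om x‖ +
        ‖fderiv ℝ (fderiv ℝ (vc k)) x‖ * ‖om x‖) := by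
      rw [hΦ]; dsimp only; rw [hvk, ← homdef]
      exact mul_le_mul_of_nonneg_right h1 (by positivity)
    have h3 := young_three_bc (n := Ns) (w := ‖om x‖) (d := ‖fderiv ℝ om x‖)
      (g := ‖fderiv ℝ v x‖) (h := ‖fderiv ℝ (fderiv ℝ (vc k)) x‖) hν
    rw [hM]; dsimp only
    linarith [h2, h3]
  have i_M : Integrable M volume := by
    rw [hM]
    exact ((iDω2.const_mul _).add (iDDk2.const_mul _)).add (((i_a.const_mul _).add (iDv2.const_mul _)).const_mul _)
  have i_Φ : Integrable Φ volume := by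
    have hm : AEStronglyMeasurable Φ volume := by
      refine Continuous.aestronglyMeasurable ?_
      rw [hΦ]
      exact ((continuous_abs.comp (cvc (k + 1))).add (continuous_abs.comp (cvc (k + 2)))).mul
        (((continuous_const.mul (cDω.norm.mul cω.norm)).add (cDv.norm.mul cDω.norm)).add
          (cDDk.norm.mul cω.norm))
    refine (i_M.div_const 2).mono' hm (Eventually.of_forall fun x => ?_)
    rw [Real.norm_of_nonneg (hΦ0 x)]
    have := hpt x
    linarith
  have hint : 2 * ∫ x, Φ x ≤ ∫ x, M x := by
    rw [← integral_const_mul]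
    exact integral_mono (i_Φ.const_mul 2) i_M hpt
  have hMval : ∫ x, M x = (2 * ν / 3) * Dop + (ν / 27) * H + Ns ^ 2 / ν * (135 * a + 3 * G) := by
    have i1 : Integrable (fun x => (2 * ν / 3) * ‖fderiv ℝ om x‖ ^ 2 +
        (ν / 27) * ‖fderiv ℝ (fderiv ℝ (vc k)) x‖ ^ 2) volume :=
      (iDω2.const_mul _).add (iDDk2.const_mul _)
    have i2 : Integrable (fun x => Ns ^ 2 / ν * (135 * ‖om x‖ ^ 2 + 3 * ‖fderiv ℝ v x‖ ^ 2)) volume :=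
      ((i_a.const_mul _).add (iDv2.const_mul _)).const_mul _
    have i3 : Integrable (fun x => 135 * ‖om x‖ ^ 2) volume := i_a.const_mul _
    have i4 : Integrable (fun x => 3 * ‖fderiv ℝ v x‖ ^ 2) volume := iDv2.const_mul _
    have i5 : Integrable (fun x => (2 * ν / 3) * ‖fderiv ℝ om x‖ ^ 2) volume := iDω2.const_mul _
    have i6 : Integrable (fun x => (ν / 27) * ‖fderiv ℝ (fderiv ℝ (vc k)) x‖ ^ 2) volume :=
      iDDk2.const_mul _
    change ∫ x, ((2 * ν / 3) * ‖fderiv ℝ om x‖ ^ 2 + (ν / 27) * ‖fderiv ℝ (fderiv ℝ (vc k)) x‖ ^ 2 +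
      Ns ^ 2 / ν * (135 * ‖om x‖ ^ 2 + 3 * ‖fderiv ℝ v x‖ ^ 2)) = _
    rw [integral_add i1 i2, integral_add i5 i6, integral_const_mul, integral_const_mul,
      integral_const_mul, integral_add i3 i4, integral_const_mul, integral_const_mul]
  -- Part 3: the count
  have hcount : (2 * ν / 3) * Dop + (ν / 27) * H + Ns ^ 2 / ν * (135 * a + 3 * G) ≤
      ν * R + 138 / ν * Ns ^ 2 * a := by
    have h1 : (2 * ν / 3) * Dop ≤ (2 * ν / 3) * R := mul_le_mul_of_nonneg_left hDopR (by positivity)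
    have h2 : (ν / 27) * H ≤ (ν / 27) * (9 * R) :=
      mul_le_mul_of_nonneg_left (hHD.trans (by nlinarith [hDopR])) (by positivity)
    have h3 : Ns ^ 2 / ν * (135 * a + 3 * G) ≤ Ns ^ 2 / ν * (138 * a) :=
      mul_le_mul_of_nonneg_left (by linarith [hGa]) (by positivity)
    have e : (2 * ν / 3) * R + (ν / 27) * (9 * R) + Ns ^ 2 / ν * (138 * a) =
        ν * R + 138 / ν * Ns ^ 2 * a := by ring
    linarith [h1, h2, h3, e]
  have hfin : 2 * ∫ x, ⟪om x, fderiv ℝ v x (om x)⟫ ≤ ν * R + 138 / ν * Ns ^ 2 * a := by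
    have := mul_le_mul_of_nonneg_left hS1 (by norm_num : (0 : ℝ) ≤ 2)
    linarith [this, hint, hMval, hcount]
  simpa only [homdef, hR, ha, hNs, hN, hvc, mul_assoc] using hfin


/-- Time measurability of the `L^∞` norms of the velocity components `u_j(t)` of a classical
solution on `(0, T)` (the `L^∞` norm of a continuous slice is its supremum over a countable
dense set; each `t ↦ |u_j(t, q)|` is continuous). [folklore] -/
private theorem aemeasurable_eLpNorm_top_apply_bc {ν T : ℝ}
    {u : ℝ → (EuclideanSpace ℝ (Fin 3)) → (EuclideanSpace ℝ (Fin 3))}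
    {p : ℝ → (EuclideanSpace ℝ (Fin 3)) → ℝ} (hsol : IsClassicalNSSolutionOn (Ico 0 T) ν 0 u p)
    (j : Fin 3) :
    AEMeasurable (fun t => eLpNorm (fun x => u t x j) ⊤ volume) (volume.restrict (Ioo 0 T)) := by
  obtain ⟨D, hDc, hDd⟩ := TopologicalSpace.exists_countable_dense (EuclideanSpace ℝ (Fin 3))
  haveI : Countable D := hDc.to_subtype
  have hcD : ContinuousOn (fun z : ℝ × EuclideanSpace ℝ (Fin 3) => u z.1 z.2) (Ioo 0 T ×ˢ univ) :=
    hsol.smooth_velocity.continuousOn.mono (prod_mono Ioo_subset_Ico_self Subset.rfl)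
  have hq : ∀ q : D, AEMeasurable (fun t => ‖u t (q : EuclideanSpace ℝ (Fin 3)) j‖ₑ)
      (volume.restrict (Ioo 0 T)) := by
    intro q
    have h1 : ContinuousOn (fun t => u t (q : EuclideanSpace ℝ (Fin 3))) (Ioo 0 T) := by
      have hm : MapsTo (fun t : ℝ => (t, (q : EuclideanSpace ℝ (Fin 3)))) (Ioo 0 T) (Ioo 0 T ×ˢ univ) :=
        fun t ht => ⟨ht, mem_univ _⟩
      exact hcD.comp (continuousOn_id.prodMk continuousOn_const) hm
    have h2 : ContinuousOn (fun t => ‖u t (q : EuclideanSpace ℝ (Fin 3)) j‖ₑ) (Ioo 0 T) :=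
      ((EuclideanSpace.proj j).continuous.comp_continuousOn h1).enorm
    exact h2.aemeasurable measurableSet_Ioo
  have hsup : AEMeasurable (fun t => ⨆ q : D, ‖u t (q : EuclideanSpace ℝ (Fin 3)) j‖ₑ)
      (volume.restrict (Ioo 0 T)) := AEMeasurable.iSup hq
  refine hsup.congr ?_
  rw [EventuallyEq, ae_restrict_iff' measurableSet_Ioo]
  refine Eventually.of_forall fun t ht => ?_
  have hc : Continuous fun x => u t x j :=
    (EuclideanSpace.proj j).continuous.comp (hsol.contDiff_velocity (Ioo_subset_Ico_self ht)).continuous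
  exact (eLpNorm_top_eq_iSup_of_continuous_bc hc hDd).symm

set_option maxHeartbeats 1600000 in
/-- **Two velocity components in `L²(0,T; L^∞)`: continuation** (the endpoint `p = ∞`, `q = 2`
of the Prodi–Serrin condition `ū ∈ L^q(0,T; L^p)`, `2/q + 3/p ≤ 1`, for two components of the
velocity — Bae–Choe 2007, Thm. 1, as restated by Beirão da Veiga 2017, §1 (1.3) and the statement
after (1.9)). For a classical unforced solution on `ℝ³ × [0, T)` in the Beale–Kato–Majda class
on every `[0, T'']`, `T'' < T`: if `u_j ∈ L²(0,T; L^∞(ℝ³))` for the two indices `j ≠ k`, the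
solution continues in the class past `T`. The weight `(276/ν)(‖u_{k+1}(t)‖²_∞ + ‖u_{k+2}(t)‖²_∞)`
is integrable and time-measurable (`aemeasurable_eLpNorm_top_apply_bc`),
`two_mul_integral_stretching_le_of_two_velocity_components_top` holds at every time of a closed
sub-slab, and the slab Grönwall inequality `integral_sq_norm_curl_le_mul_exp_of_weight_slab_ae`
with Tao's energy bound gives the uniform `H¹` bound
(`hasSobolevExtensionPast_of_uniform_H1_bound`). The printed conclusion is the strong class
`L^∞H¹ ∩ L²H²` for weak solutions. [cite: BeiraodaVeiga2017JMAA, §1 (1.3), statement after (1.9), Thm. 1.1 (pp. 3–4); BaeChoe2007CPDE, Thm. 1; Tao2011, Lemma 8.1] -/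
theorem baeChoe_two_velocity_components_criterion_top {ν : ℝ} (hν : 0 < ν) {T : ℝ} (hT : 0 < T)
    {u : ℝ → (EuclideanSpace ℝ (Fin 3)) → (EuclideanSpace ℝ (Fin 3))}
    {p : ℝ → (EuclideanSpace ℝ (Fin 3)) → ℝ}
    (hsol : IsClassicalNSSolutionOn (Ico 0 T) ν 0 u p)
    (hreg : ∀ T'' < T, HasBoundedSobolevNormsOn (Icc 0 T'') u) (k : Fin 3)
    (hU : ∀ j, j ≠ k → MemLqLp 2 ⊤ (fun t x => u t x j) (Ioo 0 T)) :
    HasSobolevExtensionPast ν u T := by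
  obtain ⟨Ce, hCetop, hTao⟩ := tao_finite_energy_smooth_energy_bound_holds
  -- the time weights
  set N : Fin 3 → ℝ → ℝ := fun j t => (eLpNorm (fun x => u t x j) ⊤ volume).toReal with hN
  have hN0 : ∀ j t, 0 ≤ N j t := fun j t => ENNReal.toReal_nonneg
  obtain ⟨hI1, -⟩ := lintegral_ofReal_toReal_rpow_lt_top_bc (q := 2) (r := ⊤) (by norm_num)
    (by norm_num) (hU (k + 1) (fin3_add_one_ne_bc k))
  obtain ⟨hI2, -⟩ := lintegral_ofReal_toReal_rpow_lt_top_bc (q := 2) (r := ⊤) (by norm_num)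
    (by norm_num) (hU (k + 2) (fin3_add_two_ne_bc k))
  have hsq : ∀ j t, ENNReal.ofReal ((eLpNorm (fun x => u t x j) ⊤ volume).toReal ^ (2 : ℝ≥0∞).toReal) =
      ENNReal.ofReal (N j t ^ 2) := fun j t => by
    rw [ENNReal.toReal_ofNat, Real.rpow_two]
  simp_rw [hsq] at hI1 hI2
  set I₁ : ℝ≥0∞ := ∫⁻ t in Ioo 0 T, ENNReal.ofReal (N (k + 1) t ^ 2) with hI₁
  set I₂ : ℝ≥0∞ := ∫⁻ t in Ioo 0 T, ENNReal.ofReal (N (k + 2) t ^ 2) with hI₂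
  have hI₁top : I₁ < ⊤ := hI1
  have hI₂top : I₂ < ⊤ := hI2
  set a : ℝ → ℝ := fun t => 276 / ν * (N (k + 1) t ^ 2 + N (k + 2) t ^ 2) with ha
  have ha0 : ∀ t, 0 ≤ a t := fun t => by positivity
  set Aw : ℝ := 276 / ν * (I₁ + I₂).toReal with hAw
  have hAw0 : 0 ≤ Aw := by positivity
  have h276 : 0 ≤ 276 / ν := by positivity
  have haE : ∀ t, ENNReal.ofReal (a t) =
      ENNReal.ofReal (276 / ν) * (ENNReal.ofReal (N (k + 1) t ^ 2) + ENNReal.ofReal (N (k + 2) t ^ 2)) := by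
    intro t
    rw [ha]; dsimp only
    rw [ENNReal.ofReal_mul h276, ENNReal.ofReal_add (sq_nonneg _) (sq_nonneg _)]
  have hNmeas : ∀ j, AEMeasurable (fun t => ENNReal.ofReal (N j t ^ 2)) (volume.restrict (Ioo 0 T)) := by
    intro j
    have hE := aemeasurable_eLpNorm_top_apply_bc hsol j
    have hNj : AEMeasurable (N j) (volume.restrict (Ioo 0 T)) :=
      ENNReal.measurable_toReal.comp_aemeasurable hE
    exact ENNReal.measurable_ofReal.comp_aemeasurable (hNj.pow_const 2)
  have hAint : ∀ T'' ≤ T, ∫⁻ t in Ioo 0 T'', ENNReal.ofReal (a t) ≤ ENNReal.ofReal Aw := by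
    intro T'' hT''
    have hCtop : ENNReal.ofReal (276 / ν) ≠ ⊤ := ENNReal.ofReal_ne_top
    calc ∫⁻ t in Ioo 0 T'', ENNReal.ofReal (a t)
        ≤ ∫⁻ t in Ioo 0 T, ENNReal.ofReal (a t) := lintegral_mono_set (Ioo_subset_Ioo le_rfl hT'')
      _ = ∫⁻ t in Ioo 0 T, ENNReal.ofReal (276 / ν) *
            (ENNReal.ofReal (N (k + 1) t ^ 2) + ENNReal.ofReal (N (k + 2) t ^ 2)) :=
          lintegral_congr fun t => haE t
      _ = ENNReal.ofReal (276 / ν) * (I₁ + I₂) := by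
          rw [lintegral_const_mul' _ _ hCtop, lintegral_add_left' (hNmeas (k + 1))]
      _ = ENNReal.ofReal Aw := by
          rw [hAw, ENNReal.ofReal_mul h276, ENNReal.ofReal_toReal]
          exact (ENNReal.add_lt_top.2 ⟨hI₁top, hI₂top⟩).ne
  -- the initial energy and enstrophy
  have hreg0 : HasBoundedSobolevNormsOn (Icc 0 (T / 2)) u := hreg (T / 2) (by linarith)
  have h00 : (0 : ℝ) ∈ Icc 0 (T / 2) := ⟨le_rfl, by linarith⟩
  set E₀ : ℝ≥0∞ := ∫⁻ x, ‖u 0 x‖ₑ ^ 2 with hE₀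
  have hE₀top : E₀ < ⊤ := by
    obtain ⟨C0, hC0'⟩ := hreg0 0
    refine lt_of_le_of_lt (le_of_eq (lintegral_congr fun x => ?_)) ((hC0' 0 h00).trans_lt ENNReal.coe_lt_top)
    rw [← ofReal_norm, ← ofReal_norm, norm_iteratedFDeriv_zero]
  have hCE : Ce * E₀ < ⊤ := ENNReal.mul_lt_top hCetop hE₀top
  set Ē : ℝ := (Ce * E₀).toReal with hĒ
  have hĒ0 : 0 ≤ Ē := ENNReal.toReal_nonneg
  set Y₀ : ℝ := ∫ x, ‖curl (u 0) x‖ ^ 2 with hY₀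
  have hY₀0 : 0 ≤ Y₀ := integral_nonneg fun x => sq_nonneg _
  set Ystar : ℝ := Y₀ * Real.exp Aw with hYstar
  have hYstar0 : 0 ≤ Ystar := by positivity
  refine hasSobolevExtensionPast_of_uniform_H1_bound hν hT hsol hreg (A := Ē + Ystar)
    (by positivity) ?_
  intro t ht
  -- a closed slab containing `t`
  set T'' : ℝ := (t + T) / 2 with hT''def
  have htT'' : t < T'' := by rw [hT''def]; linarith [ht.2]
  have hT''T : T'' < T := by rw [hT''def]; linarith [ht.2]
  have hT''pos : 0 < T'' := lt_of_le_of_lt ht.1 htT''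
  have hS : IsClassicalNSSolutionOn (Icc 0 T'') ν 0 u p :=
    hsol.mono (Icc_subset_Ico_right hT''T) (uniqueDiffOn_Icc hT''pos)
  have hB : HasBoundedSobolevNormsOn (Icc 0 T'') u := hreg T'' hT''T
  have htS : t ∈ Icc 0 T'' := ⟨ht.1, htT''.le⟩
  have hsm : ∀ s ∈ Icc 0 T'', ContDiff ℝ ∞ (u s) := fun s hs => hS.contDiff_velocity hs
  have hsm3 : ∀ s ∈ Icc 0 T'', ContDiff ℝ 3 (u s) := fun s hs => (hsm s hs).of_le (by norm_cast)
  have hsm2 : ∀ s ∈ Icc 0 T'', ContDiff ℝ 2 (u s) := fun s hs => (hsm s hs).of_le (by norm_cast)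
  have hfin : ∀ n, ∀ s ∈ Icc 0 T'', ∫⁻ x, ‖iteratedFDeriv ℝ n (u s) x‖ₑ ^ 2 < ⊤ := fun n s hs => by
    obtain ⟨Cn, hCn⟩ := hB n
    exact (hCn s hs).trans_lt ENNReal.coe_lt_top
  obtain ⟨B₀, hB₀⟩ := linfty_bound_of_hasBoundedSobolevNormsOn_holds hsm2 hB
  obtain ⟨B₁, hB₁0, hB₁⟩ := exists_forall_norm_fderiv_le_of_hasBoundedSobolevNormsOn hsm3 hB
  -- Tao's energy class on the slab
  have hfe : ∃ A : ℝ≥0∞, A < ⊤ ∧ ∀ s ∈ Icc 0 T'', ∫⁻ x, ‖u s x‖ₑ ^ 2 ≤ A := by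
    obtain ⟨C0, hC0'⟩ := hB 0
    refine ⟨C0, ENNReal.coe_lt_top, fun s hs => ?_⟩
    refine le_trans (le_of_eq (lintegral_congr fun x => ?_)) (hC0' s hs)
    rw [← ofReal_norm, ← ofReal_norm, norm_iteratedFDeriv_zero]
  obtain ⟨hen, -⟩ := hTao ν T'' hν hT''pos u p hS hfe
  have hen' : ∀ s ∈ Icc 0 T'', ∫⁻ x, ‖u s x‖ₑ ^ 2 ≤ ENNReal.ofReal Ē := fun s hs => by
    rw [hĒ, ENNReal.ofReal_toReal hCE.ne]
    exact hen s hs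
  -- the stretching estimate at every time of the slab
  have hstrS : ∀ᵐ s ∂(volume.restrict (Ioo 0 T'')),
      2 * ∫ x, ⟪curl (u s) x, fderiv ℝ (u s) x (curl (u s) x)⟫ ≤
        ν * (∫ x, frobeniusNormSq (fderiv ℝ (curl (u s)) x)) + a s * (∫ x, ‖curl (u s) x‖ ^ 2) := by
    rw [ae_restrict_iff' measurableSet_Ioo]
    refine Eventually.of_forall fun s hsI => ?_
    have hsS : s ∈ Icc 0 T'' := ⟨hsI.1.le, hsI.2.le⟩
    have h := two_mul_integral_stretching_le_of_two_velocity_components_top k hν (u s) (hsm s hsS)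
      (hS.divFree s hsS) ((hen' s hsS).trans_lt ENNReal.ofReal_lt_top) (hB₀ s hsS) (hB₁ s hsS)
      (hfin 1 s hsS) (hfin 2 s hsS)
    have hY0 : 0 ≤ ∫ x, ‖curl (u s) x‖ ^ 2 := integral_nonneg fun x => sq_nonneg _
    have hcoef : 138 / ν * (N (k + 1) s + N (k + 2) s) ^ 2 ≤ a s := by
      rw [ha]; dsimp only
      have h2 : (N (k + 1) s + N (k + 2) s) ^ 2 ≤ 2 * (N (k + 1) s ^ 2 + N (k + 2) s ^ 2) := by
        nlinarith [sq_nonneg (N (k + 1) s - N (k + 2) s)]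
      have h138 : (0 : ℝ) ≤ 138 / ν := by positivity
      calc 138 / ν * (N (k + 1) s + N (k + 2) s) ^ 2
          ≤ 138 / ν * (2 * (N (k + 1) s ^ 2 + N (k + 2) s ^ 2)) := mul_le_mul_of_nonneg_left h2 h138
        _ = 276 / ν * (N (k + 1) s ^ 2 + N (k + 2) s ^ 2) := by ring
    exact h.trans (add_le_add le_rfl (mul_le_mul_of_nonneg_right hcoef hY0))
  -- the enstrophy bound on the slab
  have hY := integral_sq_norm_curl_le_mul_exp_of_weight_slab_ae hν hT''pos hS hB ha0 hAw0
    (hAint T'' hT''T.le) hstrS t htS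
  have hYstar_le : ∫ x, ‖curl (u t) x‖ ^ 2 ≤ Ystar := hY
  -- the `H¹` quantity
  have hvt : ContDiff ℝ ∞ (u t) := hS.contDiff_velocity htS
  have hcurl_int : Integrable fun x => ‖curl (u t) x‖ ^ 2 := by
    refine integrable_sq_norm_of_lintegral_lt_top (continuous_curl (hvt.of_le (by norm_cast))) ?_
    exact lt_of_le_of_lt (lintegral_curl_sq_le (u t)) (ENNReal.mul_lt_top ENNReal.ofReal_lt_top (hfin 1 t htS))
  have hdc : ∫⁻ x, ENNReal.ofReal (frobeniusNormSq (fderiv ℝ (u t) x)) ≤ ENNReal.ofReal Ystar := by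
    refine (lintegral_frobeniusNormSq_fderiv_le_lintegral_sq_norm_curl
      (hvt.of_le (by norm_cast)) (hS.divFree t htS)
      ((hen' t htS).trans_lt ENNReal.ofReal_lt_top)).trans ?_
    rw [show (∫⁻ x, ‖curl (u t) x‖ₑ ^ 2) = ∫⁻ x, ENNReal.ofReal (‖curl (u t) x‖ ^ 2) from
      lintegral_congr fun x => by rw [← ofReal_norm, ENNReal.ofReal_pow (norm_nonneg _)],
      ← ofReal_integral_eq_lintegral_ofReal hcurl_int (Eventually.of_forall fun x => sq_nonneg _)]
    exact ENNReal.ofReal_le_ofReal hYstar_le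
  calc (∫⁻ x, ‖u t x‖ₑ ^ 2) + (∫⁻ x, ENNReal.ofReal (frobeniusNormSq (fderiv ℝ (u t) x)))
      ≤ ENNReal.ofReal Ē + ENNReal.ofReal Ystar := add_le_add (hen' t htS) hdc
    _ = ENNReal.ofReal (Ē + Ystar) := (ENNReal.ofReal_add hĒ0 hYstar0).symm

/-- **The endpoint `p = ∞` with `2/q ≤ 1`**: two velocity components in `L^α(0,T; L^∞)` for
some `2 ≤ α ≤ ∞` give continuation (Hölder in time down to `α = 2` on the bounded interval,
`MemLqLp.of_exponent_le` with `aemeasurable_eLpNorm_top_apply_bc`). [cite: BeiraodaVeiga2017JMAA, §1 (1.3) and the statement after (1.9) (p. 3); BaeChoe2007CPDE, Thm. 1] -/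
theorem baeChoe_two_velocity_components_criterion_top_of_le {ν : ℝ} (hν : 0 < ν) {T : ℝ}
    (hT : 0 < T)
    {u : ℝ → (EuclideanSpace ℝ (Fin 3)) → (EuclideanSpace ℝ (Fin 3))}
    {p : ℝ → (EuclideanSpace ℝ (Fin 3)) → ℝ}
    (hsol : IsClassicalNSSolutionOn (Ico 0 T) ν 0 u p)
    (hreg : ∀ T'' < T, HasBoundedSobolevNormsOn (Icc 0 T'') u) {α : ℝ≥0∞} (h2α : 2 ≤ α) (k : Fin 3)
    (hU : ∀ j, j ≠ k → MemLqLp α ⊤ (fun t x => u t x j) (Ioo 0 T)) :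
    HasSobolevExtensionPast ν u T := by
  refine baeChoe_two_velocity_components_criterion_top hν hT hsol hreg k fun j hj => ?_
  refine (hU j hj).of_exponent_le h2α measure_Ioo_lt_top.ne ?_
  exact (ENNReal.measurable_toReal.comp_aemeasurable
    (aemeasurable_eLpNorm_top_apply_bc hsol j)).aestronglyMeasurable

end Endpoint

end Literature.Analysis.FluidPDE
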